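import Literature.MathematicalPhysics.QuantumFieldTheory.Balaban1983to89.B3DeltaPiecesRegularNested
import Literature.MathematicalPhysics.QuantumFieldTheory.Balaban1983to89.B3Ineq211RegularRegion
import Literature.MathematicalPhysics.QuantumFieldTheory.Balaban1983to89.B1Ineq226HolderRegularRegion

/-!
# Bałaban, *(Higgs)₂,₃ quantum fields in a finite volume III* [B3] — (2.5) p. 424 with (2.11) p. 426 «This applies also to Hölder norms»:
# THE HÖLDER ENTRY of the δ-pieces `δpiece_j = G^η_{(j)}(Ω,A) − G^η_{(j)}(Ω₂,A)` of `δG_k(Ω,Ω₂,B̃) = G_k(Ω,B̃) − G_k(Ω₂,B̃)` (p. 414) AT A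
# REGULAR NON-CONSTANT BACKGROUND `B̃ = A`, FOR NESTED BIG-BLOCK REGIONS `Ω₂ ⊆ Ω ⊂ T_η`, PROVED on the concrete (Higgs)₂,₃ carrier

statement-level skeleton of published theorems with citation tags; proofs where landed; nothing here is a claim about the Yang–Mills mass gap

T. Bałaban, Commun. Math. Phys. **88** (1983) 411–445 [cite: Balaban1983Higgs3]; inputs from part I, Commun. Math. Phys. **85** (1982)
603–626 [cite: Balaban1982Higgs1] as landed in the tree.  PDF held: `paper:balaban1983-higgs-2-3-quantum-fields-finite-volume` (journal page =
PDF page + 410), p. 414 [PDF 4], p. 420 [PDF 10], p. 424 [PDF 14], p. 426 [PDF 16] (OCR `p0004.txt`, `p0010.txt`, `p0014.txt`, `p0016.txt`).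

CITATION HEADER (lean-in-tree rule).  Cell `lit-balaban` (HOME `run/shared/lean/pub/lit-balaban/`), Phase-2 proof seat **p33** gen 60 (unit
`lit-balaban-p33`; TAKING line HOME/STATUS.md 2026-08-22T23:47Z); SKELETON row **B3.Eq2.5** (fold owner r15; decl of record
`B3Sect2StatementsPart2.ScaledKernels.Ineq25`; owner division of labour HOME/STATUS 2026-08-22T22:50:53Z / 23:28:19Z, item (iv) «the Hölder
entries + the (1.32) assembly»).  THE HÖLDER TWIN of r14 g18's `B3DeltaPiecesRegularNested.dPiece_deriv_bound_explicit` (p344545: one covariant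
derivative on the LEFT factor of each telescoped term), in the way p35 g16's `B3Ineq211RegularRegion` ((2.11) on regions) is the Hölder twin of r14 g17's
`B3Ineq210RegularRegion` ((2.10) on regions).  USED BY NAME, never restated: r14 g18's δ-pieces `dPiece`/`dG`/`T1`/`T2`/`T3`, the telescoping
`dSandwich_eq`/`dPiece_of_pos`/`dPiece_zero`/`dPiece_of_le`, the coordinate domination `abs_coord_YZ_le`, the cut lemmas
`covDeriv_dG_avgQkAdj_cb_eq_zero`/`covDeriv_G_avgQkAdj_cb_eq_zero`/`norm_covDeriv_dG_eq_chi`/`dG_apply_eq_chi`, the middle factors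
`abs_mat_dC_le`/`mat_fluctCovA_eq_zero_of_not_mem`/`margin_le_of_levelSet`, the right kernels `abs_mat_QdG_le`/`mat_QdG_eq_zero`, the constants
`kT`/`cst25`; r14 g17's region machinery `levelSet`/`Interior`/`towerR`/`mat_condCov232_levelSet`/`abs_mat_QG_le_R`/`mat_QG_eq_zero_R`/
`reg223R_of_small` (`B3Ineq210RegularRegion`) and torus engine `sum3_le`/`exp_blockIter_le` (`B3Ineq210RegularTorus`); p35 g16's Hölder left kernel on a
region `B3Ineq211RegularRegion.holder_G_avgQkAdj_cb_le_R`, p26's admissible contours `IsAdm` and coordinate expansion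
`norm_hol_covDeriv_sub_le_sum_coord` (`B3Ineq211RegularTorus`); THE INPUTS: Proposition I.2.1 for big-block regions at a regular `A` — the (I.2.24)
Hölder clause (p35 g12 `B1Ineq224RegularRegion.norm_holder_propagatorK_region_reg_decay_sum`), the (I.2.25) value clause (p35 g12
`B1Ineq225RegularRegion.norm_propagatorK_region_reg_decay_sum`), the (I.2.26) value clause (p35 g12 `B1Ineq226RegularRegionSum.deltaG_region_reg_decay_sum`)
AND ITS HÖLDER MEMBER (p35 g13 `B1Ineq226HolderRegularRegion.holder_deltaG_region_reg_decay_sum`); Proposition I.2.3 for regions — (I.2.34)/(I.2.36) (r14 g14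
`B1Prop23RegularRegion.prop23_regular_region`) and (I.2.38) (r14 g14 `B1Ineq238RegularRegion.prop23_238_regular_region`).

## What is printed (verbatim)

p. 414 [PDF 4]: *"… so we will have also the propagators δG_k(Ω,Ω₂,B̃) = G_k(Ω,B̃) − G_k(Ω₂,B̃). … This estimate follows easily from the
properties of the propagators G_k(Ω,A) proved in the next paper. Also the propagator δG_k(Ω,Ω₂,B̃) will be treated as an external field"*;
(2.5) p. 424 [PDF 14]: *"‖h(an operator δG_k(Ω,Ω₂,B̃) or (1.16))h′‖_{1,α} ≤ O(e^{−δ₀dist(Ω₂,∂Ω)} or (e(L^kε)p(L^kε))^{n+n′})e^{−δ₀dist(supp h, supp h′)},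
(2.5)"*; (1.32) p. 420 [PDF 10]: *"‖f‖_{1,α} = sup_x|f(x)| + sup_{x,μ}|(D^η_{B̃,μ}f)(x)| + sup_{x,x′,μ}|x − x′|^{−α}|U(B̃(Γ_{x,x′}))(D^η_{B̃,μ}f)(x′) −
(D^η_{B̃,μ}f)(x)|"*; (2.6) p. 424 `G^η_k = Σ_{j=0}^{k−1}G^η_{(j)}`; (2.11) p. 426 [PDF 16]: *"This applies also to Hölder norms, e.g. we have
(1/|x₂−x₁|^α)|U(B̃(Γ_{x₁,x₂}))(D^η_{B̃,μ}G^η_{(j)})(Ω,B̃;x₂,x) − (D^η_{B̃,μ}G^η_{(j)})(Ω,B̃;x₁,x)| ≤ O(1)(L^jη)^{−d+1−α}e^{−δ₁(L^jη)^{−1}dist({x₁,x₂},x)},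
0 ≤ α < 1. (2.11) … They all are obtained by rescaling from the η-lattice to the L^{−j}-lattice and application of Propositions I.2.1 and
I.2.3."*; I p. 610 (2.26): *"we have the inequalities (2.24), (2.25) with the additional factor exp(−δ₀dist(supp f,Ωᶜ) − δ₀dist({x,x′},Ωᶜ))"*.

## What this file proves, and how (the published route, applied to the HÖLDER QUOTIENT of the δ-pieces)

The third summand of (1.32) for the two-variable field `δG_k(Ω,Ω₂,B̃;x,x′)` needs, piece by piece along (2.6), the transported Hölder
difference in the ROW variable of the kernel of `δpiece_j` — the (2.11)-form clause WITH THE BOUNDARY FACTOR of (2.5)/(I.2.26).  In the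
telescoped form `δpiece_j = a_j²(L^jε)^{−4}(T1 + T2 + T3)` (r14's `dSandwich_eq`) the transported difference
`U(A(Γ_{x₁,x₂}))(D^ε_{A,μ} · )(x₂) − (D^ε_{A,μ} · )(x₁)` falls on the LEFT factor of each term only — `δG_j` in (T1), `G_j(Ω₂)` in (T2), (T3) —
whose Hölder-transported kernels are the HÖLDER MEMBERS of (I.2.26) (p35 g13) and of (I.2.24) on `Ω₂` (p35 g12), one power `(L^jε)^{−α}` lower
through the weight `(|x₁−x₂|/L^j)^{−α}`; the middle and right factors, the cut lemmas, the margins of (I.2.36)/(I.2.38) and the three-kernel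
convolutions are r14's FILE 1 verbatim, run from BOTH row points `x₁`, `x₂` (§1 `holderW_XYZ_cb_le`, the Hölder twin of r14's
`norm_covDeriv_XYZ_cb_le`).  The piece `j = 0` is `δG_1`, bounded by the Hölder member of (I.2.26) at level `1` directly.  Result (§5,
`dPiece_holder_bound_explicit`): for every `0 ≤ α < 1` (constants after `α` and `K₀`, GAPS G-B3-11), at INTERIOR points `x₁ ≠ x₂`, `x′` of `Ω₂`
and every admissible contour `Γ` from `x₁` to `x₂` (p26's `IsAdm`: nearest-neighbour chain, `|Γ| ≤ d|x₁ − x₂|`),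
`ε^{−d}Σ_{i′}‖U(A(Γ))(D^ε_{A,μ}δpiece_j e_{(x′,i′)})(x₂) − (D^ε_{A,μ}δpiece_j e_{(x′,i′)})(x₁)‖
  ≤ (ε|x₁−x₂|)^α · C(L^jε)^{1−d−α} · e^{−δ₁(L^jε)^{−1}ε·min(|x₁−x′|,|x₂−x′|)} · e^{−δ₁(L^jε)^{−1}ε·m}`,
`m = min(dist(x₁,Ω₂ᶜ), dist(x₂,Ω₂ᶜ), dist(x′,Ω₂ᶜ))` (lattice-step distances `tdist`, `distC`) — (2.11)'s form with a boundary factor,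
uniformly in the volume, the regions and `k`.  The scale sum `Σ_{j<k}` and the (1.32) assembly `Ineq25` are the companion file
`B3Ineq25RegularNested` (this seat).

## Honest scope

Hölder clause in the ROW variable only (the column/mixed entries are p33 g58's `B3DeltaGkMixedRegularRegion`, the value/derivative entries
r14 g18's FILE 1); boundary factor in the MINIMUM of the three margins (weaker bookkeeping than (I.2.26)'s sum of two distances; what the
assembly uses); all three points interior (`Interior k K₀ Ω₂`: Prop. I.2.1's `R₀`-clause in the tree's constants); `m² > 0`; both regions
big-block unions (`IsBigBlockUnion k K₀`) with `K₀ ∣ M`, `3L^kK₀ ≤ |T_ε|_μ`; `A` regular ON THE LARGER REGION `Ω`; charges with `e² ≤ E₀` and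
`L^kδ_A ≤ c|e|` together with `L^kδ_A|e| ≤ t` (r14's v1.1 currency); one rate for decay and margin; constants crude, depending on
`(α, d, N, L, a, m², c, K₀)` and the charge; `Ω₂ = Ω` gives `0`.  No `def … : Prop`, no new named fact (`hwgt`, `dHolderTerm` are concrete
`def`s); axioms standard.  NOT summit progress.
-/

noncomputable section

open scoped BigOperators InnerProductSpace Matrix

namespace Literature.MathematicalPhysics.QuantumFieldTheory.Balaban1983to89.B3DeltaGkHolderRegularNested

open HiggsLattice (ChargeData ScalarField siteInner covDeriv)
open HiggsCovariance (propagatorK avgQkLin avgQkAdj E)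
open HiggsAveraging (blockIter toFinest)
open HiggsFluctMeasure (coeff221)
open B1Eq221Coordinates (fieldCoord)
open B1Eq230FluctCov (mat Ix cb fluctCovA mat_comp)
open HiggsCondCov232 (condCov232)
open B1TorusCubeCover (half)
open B1TorusCubeLocality26 (rS)
open B1TorusRegionRop (chi)
open B1TorusRegionHSizes (IsBigBlockUnion)
open B1TorusChainTransport (IsTChain hol norm_hol_apply)
open B4GaugeCovariance (pathEnd)
open B1Ineq234Concrete (profile profile_nonneg' distC distC_le distC_nonneg tdist_self)
open B1Ineq234LevelZero (tdist_comm tdist_triangle_real distC_le_tdist_add)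
open B2Eq328ConcretePieces (pieceF)
open B3Ineq210RegularTorus (norm_avgQkAdj_cb_le blockIter_eq_of_avgQkAdj_cb_ne_zero blockDist_le_tdist sum3_le exp_blockIter_le
  norm_cb_le mesh_eq_pow_mul card_Ix eq_of_cb_ne_zero aSeq_sq_le covDeriv_add'' covDeriv_smul'' covDeriv_zero'' mesh_mono)
open B3Ineq210RegularRegion (levelSet blockUnion_of_isBigBlockUnion isBigBlockUnion_of_le Interior half_mono towerR pieceF_towerR
  levelSet_blockUnion mat_condCov232_levelSet abs_mat_QG_le_R mat_QG_eq_zero_R propagatorK_apply_eq_chi reg223R_of_small)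
open B3Ineq211RegularTorus (IsAdm norm_hol_sub_le norm_hol_covDeriv_sub_le_sum_coord one_le_tdist_of_ne')
open B3Ineq211RegularRegion (holder_G_avgQkAdj_cb_le_R covDeriv_congr_bond)
open B3DeltaPiecesRegularNested (abs_coord_YZ_le dG dPiece T1 T2 T3 dSandwich_eq dPiece_zero dPiece_of_pos dPiece_of_le
  levelSet_mono dG_avgQkAdj_cb_eq_zero dG_apply_eq_chi abs_mat_QdG_le mat_QdG_eq_zero mat_fluctCovA_eq_zero_of_not_mem
  margin_le_of_levelSet mat_sub abs_mat_dC_le kT kT_nonneg cst25 cst25_pos le_cst25_zero le_cst25_pos covDeriv_dG_avgQkAdj_cb_eq_zero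
  covDeriv_G_avgQkAdj_cb_eq_zero norm_covDeriv_dG_eq_chi)

variable {P : HiggsLattice.Params} {N : ℕ}

/-! ## §0 Helpers -/

section Helpers

variable {l : ℕ}

/-- weakening a rate on a non-negative quantity. [folklore] -/
private theorem exp_rate_le {γ γ' S : ℝ} (h : γ' ≤ γ) (hS : 0 ≤ S) : Real.exp (-(γ * S)) ≤ Real.exp (-(γ' * S)) :=
  Real.exp_le_exp.mpr (neg_le_neg (mul_le_mul_of_nonneg_right h hS))

/-- `exp(−u) ≤ exp(−v)` for `v ≤ u`. [folklore] -/
private theorem exp_le_exp_neg {u v : ℝ} (h : v ≤ u) : Real.exp (-u) ≤ Real.exp (-v) :=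
  Real.exp_le_exp.mpr (neg_le_neg h)

/-- two decay factors are below twice the factor at the minimum. [folklore] -/
private theorem add_exp_le_two_exp_min {ρ : ℝ} (hρ : 0 ≤ ρ) (a b : ℝ) :
    Real.exp (-(ρ * a)) + Real.exp (-(ρ * b)) ≤ 2 * Real.exp (-(ρ * min a b)) := by
  have ha : Real.exp (-(ρ * a)) ≤ Real.exp (-(ρ * min a b)) :=
    Real.exp_le_exp.mpr (neg_le_neg (mul_le_mul_of_nonneg_left (min_le_left _ _) hρ))
  have hb : Real.exp (-(ρ * b)) ≤ Real.exp (-(ρ * min a b)) :=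
    Real.exp_le_exp.mpr (neg_le_neg (mul_le_mul_of_nonneg_left (min_le_right _ _) hρ))
  linarith

/-- The decay factor at the block distance: `exp(−δ·D/L^l) ≤ e^{δ}·exp(−δ|x_l − y|)` for `D = max(0, L^l|x_l − y| − (L^l − 1))`
(cf. `B3Ineq210RegularRegion`). [folklore] -/
private theorem exp_blockDist_le (x : HiggsLattice.Site P 0) (y : HiggsLattice.Site P l) {δ : ℝ} (hδ : 0 ≤ δ) :
    Real.exp (-(δ * (max 0 ((P.L : ℝ) ^ l * (HiggsLattice.Site.tdist (blockIter l x) y : ℝ) - ((P.L : ℝ) ^ l - 1)) / (P.L : ℝ) ^ l)))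
      ≤ Real.exp δ * Real.exp (-(δ * (HiggsLattice.Site.tdist (blockIter l x) y : ℝ))) := by
  rw [← Real.exp_add]
  apply Real.exp_le_exp.mpr
  have hT : (0 : ℝ) < (P.L : ℝ) ^ l := pow_pos (by exact_mod_cast P.hL) l
  set t : ℝ := (HiggsLattice.Site.tdist (blockIter l x) y : ℝ) with ht
  have h3 : t - 1 ≤ max 0 ((P.L : ℝ) ^ l * t - ((P.L : ℝ) ^ l - 1)) / (P.L : ℝ) ^ l := by
    rw [le_div_iff₀ hT]
    have h1 : (P.L : ℝ) ^ l * t - ((P.L : ℝ) ^ l - 1) ≤ max 0 ((P.L : ℝ) ^ l * t - ((P.L : ℝ) ^ l - 1)) := le_max_right _ _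
    nlinarith
  nlinarith [mul_le_mul_of_nonneg_left h3 hδ]

/-- The two-centre decay factor with a margin: for `D = min(D₁, D₂)` of the two block distances and a margin `ρ`,
`exp(−δ(D + ρ)/L^l) ≤ e^{δ}e^{−δρ/L^l}(e^{−δ|x₁,ₗ − y|} + e^{−δ|x₂,ₗ − y|})`. [folklore] -/
private theorem exp_twoCentre_margin_le (x₁ x₂ : HiggsLattice.Site P 0) (y : HiggsLattice.Site P l) {δ ρ : ℝ} (hδ : 0 ≤ δ) :
    Real.exp (-(δ * ((min (max 0 ((P.L : ℝ) ^ l * (HiggsLattice.Site.tdist (blockIter l x₁) y : ℝ) - ((P.L : ℝ) ^ l - 1)))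
        (max 0 ((P.L : ℝ) ^ l * (HiggsLattice.Site.tdist (blockIter l x₂) y : ℝ) - ((P.L : ℝ) ^ l - 1))) + ρ) / (P.L : ℝ) ^ l)))
      ≤ Real.exp δ * Real.exp (-(δ * (ρ / (P.L : ℝ) ^ l))) *
          (Real.exp (-(δ * (HiggsLattice.Site.tdist (blockIter l x₁) y : ℝ))) +
            Real.exp (-(δ * (HiggsLattice.Site.tdist (blockIter l x₂) y : ℝ)))) := by
  set D₁ : ℝ := max 0 ((P.L : ℝ) ^ l * (HiggsLattice.Site.tdist (blockIter l x₁) y : ℝ) - ((P.L : ℝ) ^ l - 1)) with hD₁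
  set D₂ : ℝ := max 0 ((P.L : ℝ) ^ l * (HiggsLattice.Site.tdist (blockIter l x₂) y : ℝ) - ((P.L : ℝ) ^ l - 1)) with hD₂
  have hsplit : Real.exp (-(δ * ((min D₁ D₂ + ρ) / (P.L : ℝ) ^ l)))
      = Real.exp (-(δ * (min D₁ D₂ / (P.L : ℝ) ^ l))) * Real.exp (-(δ * (ρ / (P.L : ℝ) ^ l))) := by
    rw [← Real.exp_add]; congr 1; rw [add_div]; ring
  rw [hsplit]
  have h1 := exp_blockDist_le (P := P) x₁ y hδ
  have h2 := exp_blockDist_le (P := P) x₂ y hδ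
  rw [← hD₁] at h1
  rw [← hD₂] at h2
  have e1 : 0 ≤ Real.exp δ * Real.exp (-(δ * (HiggsLattice.Site.tdist (blockIter l x₁) y : ℝ))) := by positivity
  have e2 : 0 ≤ Real.exp δ * Real.exp (-(δ * (HiggsLattice.Site.tdist (blockIter l x₂) y : ℝ))) := by positivity
  have hmin : Real.exp (-(δ * (min D₁ D₂ / (P.L : ℝ) ^ l)))
      ≤ Real.exp δ * (Real.exp (-(δ * (HiggsLattice.Site.tdist (blockIter l x₁) y : ℝ))) +
          Real.exp (-(δ * (HiggsLattice.Site.tdist (blockIter l x₂) y : ℝ)))) := by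
    rcases min_choice D₁ D₂ with hm | hm <;> rw [hm] <;> linarith
  have hρ0 : 0 ≤ Real.exp (-(δ * (ρ / (P.L : ℝ) ^ l))) := (Real.exp_pos _).le
  calc Real.exp (-(δ * (min D₁ D₂ / (P.L : ℝ) ^ l))) * Real.exp (-(δ * (ρ / (P.L : ℝ) ^ l)))
      ≤ (Real.exp δ * (Real.exp (-(δ * (HiggsLattice.Site.tdist (blockIter l x₁) y : ℝ))) +
          Real.exp (-(δ * (HiggsLattice.Site.tdist (blockIter l x₂) y : ℝ))))) * Real.exp (-(δ * (ρ / (P.L : ℝ) ^ l))) :=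
        mul_le_mul_of_nonneg_right hmin hρ0
    _ = _ := by ring

end Helpers

/-! ## §1 The Hölder engine: three-factor domination with the transported difference on the left factor, from both row points

For operators `X : T^{(l)} → T_ε` (in print `G·Q^*` or `δG·Q^*`), `Y` on `T^{(l)}`, `Z : T_ε → T^{(l)}` as in r14's `norm_XYZ_cb_le`, and a
weight `W ≥ 0` (the Hölder weight `(|x₁−x₂|/L^l)^{−α}`): if `W‖U(A(Γ))(D^ε_A(Xe_s))(⟨x₂,μ⟩) − (D^ε_A(Xe_s))(⟨x₁,μ⟩)‖ ≤ F_X(s)` on `S_L` and both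
derivatives vanish off `S_L`, then `W‖U(A(Γ))(D^ε_A(XYZe_q))(⟨x₂,μ⟩) − (D^ε_A(XYZe_q))(⟨x₁,μ⟩)‖ ≤ Σ_sΣ_t F_X(s)F_Y(s,t)F_Z(t)` (p26's coordinate
expansion `norm_hol_covDeriv_sub_le_sum_coord` + r14's `abs_coord_YZ_le`). -/

section Engine

variable (C : ChargeData N) (A : HiggsLattice.VecField P 0) {l : ℕ}

/-- **Three-factor domination, Hölder-transported on the left factor.** [cite: Balaban1983Higgs3, (2.11) p.426]
[cite: Balaban1982Higgs1, (1.7) p.605, (2.43) p.612] -/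
theorem holderW_XYZ_cb_le (XQ : ScalarField P l N →ₗ[ℝ] ScalarField P 0 N) (Y : ScalarField P l N →ₗ[ℝ] ScalarField P l N)
    (QZ : ScalarField P 0 N →ₗ[ℝ] ScalarField P l N) (SL SR : Finset (HiggsLattice.Site P l))
    {FX FZ : HiggsLattice.Site P l × Ix N → ℝ} {FY : HiggsLattice.Site P l × Ix N → HiggsLattice.Site P l × Ix N → ℝ}
    (hFX : ∀ s, 0 ≤ FX s) (hFY : ∀ s t, 0 ≤ FY s t) (hFZ : ∀ t, 0 ≤ FZ t) {W : ℝ} (hW : 0 ≤ W)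
    {q : HiggsLattice.Site P 0 × Ix N} {x₁ x₂ : HiggsLattice.Site P 0} {Γ : List (HiggsLattice.Site P 0)} {μ : Fin P.d}
    (hX : ∀ s, s.1 ∈ SL → W * ‖hol C A x₁ Γ (covDeriv C A (XQ (cb P N l s)) ⟨x₂, μ⟩) - covDeriv C A (XQ (cb P N l s)) ⟨x₁, μ⟩‖ ≤ FX s)
    (hX1 : ∀ s, s.1 ∉ SL → covDeriv C A (XQ (cb P N l s)) ⟨x₁, μ⟩ = 0)
    (hX2 : ∀ s, s.1 ∉ SL → covDeriv C A (XQ (cb P N l s)) ⟨x₂, μ⟩ = 0)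
    (hY : ∀ s t, s.1 ∈ SL → t.1 ∈ SR → |mat Y s t| ≤ FY s t)
    (hZ : ∀ t, t.1 ∈ SR → |mat QZ t q| ≤ FZ t) (hZ0 : ∀ t, t.1 ∉ SR → mat QZ t q = 0) :
    W * ‖hol C A x₁ Γ (covDeriv C A ((XQ ∘ₗ Y ∘ₗ QZ) (cb P N 0 q)) ⟨x₂, μ⟩) - covDeriv C A ((XQ ∘ₗ Y ∘ₗ QZ) (cb P N 0 q)) ⟨x₁, μ⟩‖
      ≤ ∑ s : HiggsLattice.Site P l × Ix N, ∑ t : HiggsLattice.Site P l × Ix N, FX s * FY s t * FZ t := by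
  have h0 : (XQ ∘ₗ Y ∘ₗ QZ) (cb P N 0 q) = XQ (Y (QZ (cb P N 0 q))) := by simp only [LinearMap.comp_apply]
  rw [h0]
  refine (mul_le_mul_of_nonneg_left (norm_hol_covDeriv_sub_le_sum_coord C A XQ _ x₁ x₂ Γ μ) hW).trans ?_
  rw [Finset.mul_sum]
  refine Finset.sum_le_sum fun s _ => ?_
  by_cases hs : s.1 ∈ SL
  · have h1 : |fieldCoord (E N) (HiggsLattice.Site P l) (Y (QZ (cb P N 0 q))) s| ≤ ∑ t, FY s t * FZ t := by
      refine (abs_coord_YZ_le Y QZ s q).trans (Finset.sum_le_sum fun t _ => ?_)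
      by_cases ht : t.1 ∈ SR
      · exact mul_le_mul (hY s t hs ht) (hZ t ht) (abs_nonneg _) (hFY s t)
      · rw [hZ0 t ht, abs_zero, mul_zero]; exact mul_nonneg (hFY s t) (hFZ t)
    calc W * (|fieldCoord (E N) (HiggsLattice.Site P l) (Y (QZ (cb P N 0 q))) s| *
          ‖hol C A x₁ Γ (covDeriv C A (XQ (cb P N l s)) ⟨x₂, μ⟩) - covDeriv C A (XQ (cb P N l s)) ⟨x₁, μ⟩‖)
        = |fieldCoord (E N) (HiggsLattice.Site P l) (Y (QZ (cb P N 0 q))) s| *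
          (W * ‖hol C A x₁ Γ (covDeriv C A (XQ (cb P N l s)) ⟨x₂, μ⟩) - covDeriv C A (XQ (cb P N l s)) ⟨x₁, μ⟩‖) := by ring
      _ ≤ (∑ t, FY s t * FZ t) * FX s := mul_le_mul h1 (hX s hs) (mul_nonneg hW (norm_nonneg _))
          (Finset.sum_nonneg fun t _ => mul_nonneg (hFY s t) (hFZ t))
      _ = ∑ t, FX s * FY s t * FZ t := by rw [Finset.sum_mul]; exact Finset.sum_congr rfl fun t _ => by ring
  · rw [hX1 s hs, hX2 s hs, map_zero, sub_zero, norm_zero, mul_zero, mul_zero]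
    exact Finset.sum_nonneg fun t _ => mul_nonneg (mul_nonneg (hFX s) (hFY s t)) (hFZ t)

/-- **The Hölder engine with exponential majorants** (the left kernel centred at the blocks of BOTH row points):
`F_X = c_X(e^{−δ|x₁,ₗ−y_s|} + e^{−δ|x₂,ₗ−y_s|})`, `F_Y = c_Ye^{−δ|y_s−y_t|}`, `F_Z = c_Ze^{−δ|(x_q)_l−y_t|}` give
`W‖…‖ ≤ c_Xc_Yc_Z·K(δ/2)²e^{δ/2}·2e^{−(δ/2)min(|x₁−x_q|,|x₂−x_q|)/L^l}` (two three-kernel convolutions `sum3_le`).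
[cite: Balaban1983Higgs3, (2.6) p.424, (2.11) p.426] [cite: Balaban1982Higgs1, (2.43) p.612] -/
theorem holderW_XYZ_cb_exp_le (hl : l ≤ P.K) (XQ : ScalarField P l N →ₗ[ℝ] ScalarField P 0 N)
    (Y : ScalarField P l N →ₗ[ℝ] ScalarField P l N) (QZ : ScalarField P 0 N →ₗ[ℝ] ScalarField P l N)
    (SL SR : Finset (HiggsLattice.Site P l)) {cX cY cZ δ : ℝ} (hcX : 0 ≤ cX) (hcY : 0 ≤ cY) (hcZ : 0 ≤ cZ) (hδ : 0 < δ) {W : ℝ}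
    (hW : 0 ≤ W) {q : HiggsLattice.Site P 0 × Ix N} {x₁ x₂ : HiggsLattice.Site P 0} {Γ : List (HiggsLattice.Site P 0)} {μ : Fin P.d}
    (hX : ∀ s, s.1 ∈ SL → W * ‖hol C A x₁ Γ (covDeriv C A (XQ (cb P N l s)) ⟨x₂, μ⟩) - covDeriv C A (XQ (cb P N l s)) ⟨x₁, μ⟩‖
      ≤ cX * (Real.exp (-(δ * (HiggsLattice.Site.tdist (blockIter l x₁) s.1 : ℝ))) +
          Real.exp (-(δ * (HiggsLattice.Site.tdist (blockIter l x₂) s.1 : ℝ)))))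
    (hX1 : ∀ s, s.1 ∉ SL → covDeriv C A (XQ (cb P N l s)) ⟨x₁, μ⟩ = 0)
    (hX2 : ∀ s, s.1 ∉ SL → covDeriv C A (XQ (cb P N l s)) ⟨x₂, μ⟩ = 0)
    (hY : ∀ s t, s.1 ∈ SL → t.1 ∈ SR → |mat Y s t| ≤ cY * Real.exp (-(δ * (HiggsLattice.Site.tdist s.1 t.1 : ℝ))))
    (hZ : ∀ t, t.1 ∈ SR → |mat QZ t q| ≤ cZ * Real.exp (-(δ * (HiggsLattice.Site.tdist (blockIter l q.1) t.1 : ℝ))))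
    (hZ0 : ∀ t, t.1 ∉ SR → mat QZ t q = 0) :
    W * ‖hol C A x₁ Γ (covDeriv C A ((XQ ∘ₗ Y ∘ₗ QZ) (cb P N 0 q)) ⟨x₂, μ⟩) - covDeriv C A ((XQ ∘ₗ Y ∘ₗ QZ) (cb P N 0 q)) ⟨x₁, μ⟩‖
      ≤ cX * cY * cZ * (profile P N (δ / 2) ^ 2 * Real.exp (δ / 2)) *
          (2 * Real.exp (-(δ / 2 * (min (HiggsLattice.Site.tdist x₁ q.1 : ℝ) (HiggsLattice.Site.tdist x₂ q.1 : ℝ) / (P.L : ℝ) ^ l)))) := by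
  have h := holderW_XYZ_cb_le C A XQ Y QZ SL SR
    (FX := fun s => cX * (Real.exp (-(δ * (HiggsLattice.Site.tdist (blockIter l x₁) s.1 : ℝ))) +
      Real.exp (-(δ * (HiggsLattice.Site.tdist (blockIter l x₂) s.1 : ℝ)))))
    (FY := fun s t => cY * Real.exp (-(δ * (HiggsLattice.Site.tdist s.1 t.1 : ℝ))))
    (FZ := fun t => cZ * Real.exp (-(δ * (HiggsLattice.Site.tdist (blockIter l q.1) t.1 : ℝ))))
    (fun s => by positivity) (fun s t => by positivity) (fun t => by positivity) hW hX hX1 hX2 hY hZ hZ0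
  refine h.trans ?_
  have hK : 0 ≤ profile P N (δ / 2) := profile_nonneg' _ (by linarith)
  have hT : (0 : ℝ) < (P.L : ℝ) ^ l := pow_pos (by exact_mod_cast P.hL) l
  calc ∑ s : HiggsLattice.Site P l × Ix N, ∑ t : HiggsLattice.Site P l × Ix N,
        cX * (Real.exp (-(δ * (HiggsLattice.Site.tdist (blockIter l x₁) s.1 : ℝ))) +
            Real.exp (-(δ * (HiggsLattice.Site.tdist (blockIter l x₂) s.1 : ℝ)))) *
          (cY * Real.exp (-(δ * (HiggsLattice.Site.tdist s.1 t.1 : ℝ)))) *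
          (cZ * Real.exp (-(δ * (HiggsLattice.Site.tdist (blockIter l q.1) t.1 : ℝ))))
      = cX * cY * cZ * ((∑ s : HiggsLattice.Site P l × Ix N, ∑ t : HiggsLattice.Site P l × Ix N,
          Real.exp (-(δ * (HiggsLattice.Site.tdist (blockIter l x₁) s.1 : ℝ))) *
            Real.exp (-(δ * (HiggsLattice.Site.tdist s.1 t.1 : ℝ))) *
            Real.exp (-(δ * (HiggsLattice.Site.tdist (blockIter l q.1) t.1 : ℝ)))) +
          (∑ s : HiggsLattice.Site P l × Ix N, ∑ t : HiggsLattice.Site P l × Ix N,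
          Real.exp (-(δ * (HiggsLattice.Site.tdist (blockIter l x₂) s.1 : ℝ))) *
            Real.exp (-(δ * (HiggsLattice.Site.tdist s.1 t.1 : ℝ))) *
            Real.exp (-(δ * (HiggsLattice.Site.tdist (blockIter l q.1) t.1 : ℝ))))) := by
        rw [← Finset.sum_add_distrib, Finset.mul_sum]
        refine Finset.sum_congr rfl fun s _ => ?_
        rw [← Finset.sum_add_distrib, Finset.mul_sum]
        refine Finset.sum_congr rfl fun t _ => ?_
        ring
    _ ≤ cX * cY * cZ * (profile P N (δ / 2) ^ 2 *
          Real.exp (-(δ / 2 * (HiggsLattice.Site.tdist (blockIter l x₁) (blockIter l q.1) : ℝ))) +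
          profile P N (δ / 2) ^ 2 *
          Real.exp (-(δ / 2 * (HiggsLattice.Site.tdist (blockIter l x₂) (blockIter l q.1) : ℝ)))) :=
        mul_le_mul_of_nonneg_left (add_le_add (sum3_le hδ (blockIter l x₁) (blockIter l q.1) q.2)
          (sum3_le hδ (blockIter l x₂) (blockIter l q.1) q.2)) (by positivity)
    _ ≤ cX * cY * cZ * (profile P N (δ / 2) ^ 2 * (Real.exp (δ / 2) *
          Real.exp (-(δ / 2 * ((HiggsLattice.Site.tdist x₁ q.1 : ℝ) / (P.L : ℝ) ^ l)))) +
          profile P N (δ / 2) ^ 2 * (Real.exp (δ / 2) *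
          Real.exp (-(δ / 2 * ((HiggsLattice.Site.tdist x₂ q.1 : ℝ) / (P.L : ℝ) ^ l))))) :=
        mul_le_mul_of_nonneg_left (add_le_add
          (mul_le_mul_of_nonneg_left (exp_blockIter_le hl hδ.le x₁ q.1) (pow_nonneg hK 2))
          (mul_le_mul_of_nonneg_left (exp_blockIter_le hl hδ.le x₂ q.1) (pow_nonneg hK 2))) (by positivity)
    _ = cX * cY * cZ * (profile P N (δ / 2) ^ 2 * Real.exp (δ / 2)) *
          (Real.exp (-(δ / 2 * ((HiggsLattice.Site.tdist x₁ q.1 : ℝ) / (P.L : ℝ) ^ l))) +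
            Real.exp (-(δ / 2 * ((HiggsLattice.Site.tdist x₂ q.1 : ℝ) / (P.L : ℝ) ^ l)))) := by ring
    _ ≤ _ := by
        refine mul_le_mul_of_nonneg_left ?_ (by positivity)
        rw [← min_div_div_right hT.le]
        exact add_exp_le_two_exp_min (by linarith) _ _

end Engine

/-! ## §2 The left kernels, Hölder-transported: `δG_lQ_l^*e_s` by the Hölder member of (I.2.26), `G_l(Ω₂)Q_l^*e_s` by (I.2.24) (p35 g16's
`holder_G_avgQkAdj_cb_le_R`, by name); the three telescoped terms at interior row points `x₁ ≠ x₂` and interior source `x_q` -/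

section Terms

variable (C : ChargeData N) (Ω Ω₂ : Finset (HiggsLattice.Site P 0)) (A : HiggsLattice.VecField P 0) (msq a : ℝ) {l : ℕ} {α : ℝ}

/-- **On bonds of `Ω₂`, `D^ε_A(δG_lg) = −D^ε_A(G_l(Ω₂)(1_{Ω₂}g) − G_l(Ω)(1_Ωg))`** — the signed dictionary to p35's (I.2.26) statements (r14's
`norm_covDeriv_dG_eq_chi` is its normed form). [cite: Balaban1982Higgs1, Prop. 2.1 (2.26) p.610, (1.7) p.605] -/
theorem covDeriv_dG_eq_neg_chi (hsub : Ω₂ ⊆ Ω) (hmsq : 0 < msq) (hak : 0 ≤ B1.aSeq a P.L l)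
    (hΩ : ∀ x x' : HiggsLattice.Site P 0, blockIter l x = blockIter l x' → (x ∈ Ω ↔ x' ∈ Ω))
    (hΩ₂ : ∀ x x' : HiggsLattice.Site P 0, blockIter l x = blockIter l x' → (x ∈ Ω₂ ↔ x' ∈ Ω₂))
    (g : ScalarField P 0 N) {b : HiggsLattice.PBond P 0} (hb : b.src ∈ Ω₂) (hb' : b.tgt ∈ Ω₂) :
    covDeriv C A (dG C Ω Ω₂ A msq a l g) b
      = -covDeriv C A (propagatorK C Ω₂ A msq a l (chi Ω₂ • g) - propagatorK C Ω A msq a l (chi Ω • g)) b := by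
  have hv : ∀ y ∈ Ω₂, dG C Ω Ω₂ A msq a l g y
      = -((propagatorK C Ω₂ A msq a l (chi Ω₂ • g) - propagatorK C Ω A msq a l (chi Ω • g)) y) := by
    intro y hy
    rw [Pi.sub_apply, neg_sub, dG_apply_eq_chi C Ω Ω₂ A msq a hsub hmsq hak hΩ hΩ₂ g hy]
  rw [B1Cor23RegularRegion.covDeriv_eq, B1Cor23RegularRegion.covDeriv_eq, hv _ hb', hv _ hb, map_neg, ← smul_neg]
  congr 1
  abel

/-- **(T1)'s left kernel, Hölder-transported**, from the (I.2.26) Hölder engine `h26H` at interior row points `x₁ ≠ x₂` with a common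
margin `ρ` from `Ω₂ᶜ`: `W·‖U(A(Γ))(D^ε_A δG_lQ_l^*e_s)(⟨x₂,μ⟩) − (D^ε_A δG_lQ_l^*e_s)(⟨x₁,μ⟩)‖ ≤ c₂₆e^{δ}e^{−δρ/L^l}(e^{−δ|x₁,ₗ−y_s|} + e^{−δ|x₂,ₗ−y_s|})√N`,
`W = (|x₁−x₂|/L^l)^{−α}`. [cite: Balaban1982Higgs1, Prop. 2.1 (2.26) with (2.24) p.610] [cite: Balaban1983Higgs3, (2.11) p.426] -/
theorem holderW_dG_avgQkAdj_cb_le (hl : l ≤ P.K) {good : HiggsLattice.Site P 0 → Prop} {c26 δ ρ : ℝ} (hc : 0 ≤ c26)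
    (hδ : 0 ≤ δ) (hρ : 0 ≤ ρ)
    (h26H : ∀ (g : ScalarField P 0 N) (M D D₀ : ℝ), (∀ x, ‖g x‖ ≤ M) → 0 ≤ D → 0 ≤ D₀ →
      ∀ (μ : Fin P.d) (x x' : HiggsLattice.Site P 0), x' ≠ x → good x → good x' →
        ∀ Γ : List (HiggsLattice.Site P 0), IsTChain x Γ → pathEnd x Γ = x' → (Γ.length : ℝ) ≤ (P.d : ℝ) * HiggsLattice.Site.tdist x x' →
        (∀ z, g z ≠ 0 → D ≤ (HiggsLattice.Site.tdist x z : ℝ)) → (∀ z, g z ≠ 0 → D ≤ (HiggsLattice.Site.tdist x' z : ℝ)) →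
        (∀ z, z ∉ Ω₂ → D₀ ≤ (HiggsLattice.Site.tdist x z : ℝ)) → (∀ z, z ∉ Ω₂ → D₀ ≤ (HiggsLattice.Site.tdist x' z : ℝ)) →
          (((HiggsLattice.Site.tdist x x' : ℝ) / (P.L : ℝ) ^ l)⁻¹) ^ α *
              ‖hol C A x Γ (covDeriv C A (dG C Ω Ω₂ A msq a l g) ⟨x', μ⟩) - covDeriv C A (dG C Ω Ω₂ A msq a l g) ⟨x, μ⟩‖
            ≤ c26 * Real.exp (-(δ * ((D + D₀) / (P.L : ℝ) ^ l))) * M)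
    (s : HiggsLattice.Site P l × Ix N) (μ : Fin P.d) {x₁ x₂ : HiggsLattice.Site P 0} (hne : x₂ ≠ x₁) (hx₁ : good x₁) (hx₂ : good x₂)
    {Γ : List (HiggsLattice.Site P 0)} (hΓ : IsAdm x₁ x₂ Γ)
    (hρ₁ : ∀ z, z ∉ Ω₂ → ρ ≤ (HiggsLattice.Site.tdist x₁ z : ℝ)) (hρ₂ : ∀ z, z ∉ Ω₂ → ρ ≤ (HiggsLattice.Site.tdist x₂ z : ℝ)) :
    (((HiggsLattice.Site.tdist x₁ x₂ : ℝ) / (P.L : ℝ) ^ l)⁻¹) ^ α *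
        ‖hol C A x₁ Γ (covDeriv C A (dG C Ω Ω₂ A msq a l (avgQkAdj C A l (cb P N l s))) ⟨x₂, μ⟩)
          - covDeriv C A (dG C Ω Ω₂ A msq a l (avgQkAdj C A l (cb P N l s))) ⟨x₁, μ⟩‖
      ≤ c26 * Real.exp δ * Real.exp (-(δ * (ρ / (P.L : ℝ) ^ l))) *
          (Real.exp (-(δ * (HiggsLattice.Site.tdist (blockIter l x₁) s.1 : ℝ))) +
            Real.exp (-(δ * (HiggsLattice.Site.tdist (blockIter l x₂) s.1 : ℝ)))) * Real.sqrt N := by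
  set D₁ : ℝ := max 0 ((P.L : ℝ) ^ l * (HiggsLattice.Site.tdist (blockIter l x₁) s.1 : ℝ) - ((P.L : ℝ) ^ l - 1)) with hD₁
  set D₂ : ℝ := max 0 ((P.L : ℝ) ^ l * (HiggsLattice.Site.tdist (blockIter l x₂) s.1 : ℝ) - ((P.L : ℝ) ^ l - 1)) with hD₂
  have h := h26H (avgQkAdj C A l (cb P N l s)) (Real.sqrt N) (min D₁ D₂) ρ (norm_avgQkAdj_cb_le C A s)
    (le_min (le_max_left _ _) (le_max_left _ _)) hρ μ x₁ x₂ hne hx₁ hx₂ Γ hΓ.1 hΓ.2.1 hΓ.2.2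
    (fun z hz => (min_le_left _ _).trans (blockDist_le_tdist hl x₁ s.1 (blockIter_eq_of_avgQkAdj_cb_ne_zero C A s hz)))
    (fun z hz => (min_le_right _ _).trans (blockDist_le_tdist hl x₂ s.1 (blockIter_eq_of_avgQkAdj_cb_ne_zero C A s hz)))
    hρ₁ hρ₂
  refine h.trans ?_
  have he := exp_twoCentre_margin_le (P := P) x₁ x₂ s.1 (ρ := ρ) hδ
  rw [← hD₁, ← hD₂] at he
  have hsq : 0 ≤ Real.sqrt (N : ℝ) := Real.sqrt_nonneg _
  calc c26 * Real.exp (-(δ * ((min D₁ D₂ + ρ) / (P.L : ℝ) ^ l))) * Real.sqrt N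
      ≤ c26 * (Real.exp δ * Real.exp (-(δ * (ρ / (P.L : ℝ) ^ l))) *
          (Real.exp (-(δ * (HiggsLattice.Site.tdist (blockIter l x₁) s.1 : ℝ))) +
            Real.exp (-(δ * (HiggsLattice.Site.tdist (blockIter l x₂) s.1 : ℝ))))) * Real.sqrt N :=
        mul_le_mul_of_nonneg_right (mul_le_mul_of_nonneg_left he hc) hsq
    _ = _ := by ring

/-- **(T1), Hölder-transported, at interior row points and interior source**: the left kernel from the (I.2.26) Hölder engine `h26H`
(constant `c₂₆″`), the middle (I.2.34) for `Ω`, the right (I.2.25) for `Ω` by adjointness — r14's `normD_T1_cb_le` run from both row points.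
[cite: Balaban1983Higgs3, (2.6) p.424, (2.11) p.426] [cite: Balaban1982Higgs1, Prop. 2.1 (2.24)–(2.26) p.610, Prop. 2.3 (2.34) p.611] -/
theorem normH_T1_cb_le (hl : l ≤ P.K) (hsub : Ω₂ ⊆ Ω) (hmsq : 0 < msq) (hak : 0 ≤ B1.aSeq a P.L l)
    (hΩ : ∀ x x' : HiggsLattice.Site P 0, blockIter l x = blockIter l x' → (x ∈ Ω ↔ x' ∈ Ω))
    (hΩ₂ : ∀ x x' : HiggsLattice.Site P 0, blockIter l x = blockIter l x' → (x ∈ Ω₂ ↔ x' ∈ Ω₂))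
    {good : HiggsLattice.Site P 0 → Prop} (hgood₂ : ∀ x, good x → x ∈ Ω₂)
    (hgood₂' : ∀ (x : HiggsLattice.Site P 0) (μ : Fin P.d), good x → x.shift μ ∈ Ω₂) {c26 cG cC δ : ℝ} (hc26 : 0 ≤ c26)
    (hcG : 0 ≤ cG) (hcC : 0 ≤ cC) (hδ : 0 < δ)
    (h26H : ∀ (g : ScalarField P 0 N) (M D D₀ : ℝ), (∀ x, ‖g x‖ ≤ M) → 0 ≤ D → 0 ≤ D₀ →
      ∀ (μ : Fin P.d) (x x' : HiggsLattice.Site P 0), x' ≠ x → good x → good x' →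
        ∀ Γ : List (HiggsLattice.Site P 0), IsTChain x Γ → pathEnd x Γ = x' → (Γ.length : ℝ) ≤ (P.d : ℝ) * HiggsLattice.Site.tdist x x' →
        (∀ z, g z ≠ 0 → D ≤ (HiggsLattice.Site.tdist x z : ℝ)) → (∀ z, g z ≠ 0 → D ≤ (HiggsLattice.Site.tdist x' z : ℝ)) →
        (∀ z, z ∉ Ω₂ → D₀ ≤ (HiggsLattice.Site.tdist x z : ℝ)) → (∀ z, z ∉ Ω₂ → D₀ ≤ (HiggsLattice.Site.tdist x' z : ℝ)) →
          (((HiggsLattice.Site.tdist x x' : ℝ) / (P.L : ℝ) ^ l)⁻¹) ^ α *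
              ‖hol C A x Γ (covDeriv C A (dG C Ω Ω₂ A msq a l g) ⟨x', μ⟩) - covDeriv C A (dG C Ω Ω₂ A msq a l g) ⟨x, μ⟩‖
            ≤ c26 * Real.exp (-(δ * ((D + D₀) / (P.L : ℝ) ^ l))) * M)
    (hG : ∀ (g : ScalarField P 0 N) (M D : ℝ), (∀ x, ‖g x‖ ≤ M) → 0 ≤ D →
      ∀ x, good x → (∀ z, g z ≠ 0 → D ≤ (HiggsLattice.Site.tdist x z : ℝ)) →
        ‖propagatorK C Ω A msq a l g x‖ ≤ cG * Real.exp (-(δ * (D / (P.L : ℝ) ^ l))) * M)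
    (hC : ∀ s t : HiggsLattice.Site P l × Ix N, s.1 ∈ levelSet l Ω → t.1 ∈ levelSet l Ω →
      |mat (fluctCovA C Ω A msq a l) s t| ≤ cC * Real.exp (-(δ * (HiggsLattice.Site.tdist s.1 t.1 : ℝ))))
    {q : HiggsLattice.Site P 0 × Ix N} (hq : good q.1) (μ : Fin P.d) {x₁ x₂ : HiggsLattice.Site P 0} (hne : x₂ ≠ x₁)
    (hx₁ : good x₁) (hx₂ : good x₂) {Γ : List (HiggsLattice.Site P 0)} (hΓ : IsAdm x₁ x₂ Γ) {ρ : ℝ} (hρ : 0 ≤ ρ)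
    (hρ₁ : ∀ z, z ∉ Ω₂ → ρ ≤ (HiggsLattice.Site.tdist x₁ z : ℝ)) (hρ₂ : ∀ z, z ∉ Ω₂ → ρ ≤ (HiggsLattice.Site.tdist x₂ z : ℝ)) :
    (((HiggsLattice.Site.tdist x₁ x₂ : ℝ) / (P.L : ℝ) ^ l)⁻¹) ^ α *
        ‖hol C A x₁ Γ (covDeriv C A (T1 C Ω Ω₂ A msq a l (cb P N 0 q)) ⟨x₂, μ⟩) - covDeriv C A (T1 C Ω Ω₂ A msq a l (cb P N 0 q)) ⟨x₁, μ⟩‖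
      ≤ (c26 * Real.exp δ * Real.exp (-(δ * (ρ / (P.L : ℝ) ^ l))) * Real.sqrt N) * cC *
          ((((P.L : ℝ) ^ l) ^ P.d)⁻¹ * (cG * Real.exp δ * Real.sqrt N)) * (profile P N (δ / 2) ^ 2 * Real.exp (δ / 2)) *
          (2 * Real.exp (-(δ / 2 * (min (HiggsLattice.Site.tdist x₁ q.1 : ℝ) (HiggsLattice.Site.tdist x₂ q.1 : ℝ) / (P.L : ℝ) ^ l)))) := by
  have hW : 0 ≤ (((HiggsLattice.Site.tdist x₁ x₂ : ℝ) / (P.L : ℝ) ^ l)⁻¹) ^ α :=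
    Real.rpow_nonneg (inv_nonneg.mpr (by positivity)) _
  unfold T1
  refine holderW_XYZ_cb_exp_le C A hl _ _ _ (levelSet l Ω) (levelSet l Ω) (by positivity) hcC (by positivity) hδ hW
    (fun s _ => ?_) (fun s hs => ?_) (fun s hs => ?_) hC (fun t _ => ?_) (fun t ht => ?_)
  · simp only [LinearMap.comp_apply]
    exact (holderW_dG_avgQkAdj_cb_le C Ω Ω₂ A msq a hl hc26 hδ.le hρ h26H s μ hne hx₁ hx₂ hΓ hρ₁ hρ₂).trans (le_of_eq (by ring))
  · rw [LinearMap.comp_apply]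
    exact covDeriv_dG_avgQkAdj_cb_eq_zero C Ω Ω₂ A msq a hsub hmsq hak hΩ hΩ₂ s hs (hgood₂ _ hx₁) (hgood₂' _ μ hx₁)
  · rw [LinearMap.comp_apply]
    exact covDeriv_dG_avgQkAdj_cb_eq_zero C Ω Ω₂ A msq a hsub hmsq hak hΩ hΩ₂ s hs (hgood₂ _ hx₂) (hgood₂' _ μ hx₂)
  · exact (abs_mat_QG_le_R C Ω A msq a hl hcG hδ.le hG t hq).trans (le_of_eq (by ring))
  · exact mat_QG_eq_zero_R C Ω A msq a hmsq hak hΩ t ht (hsub (hgood₂ _ hq))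

/-- **(T3), Hölder-transported** (level `j + 1`): the left kernel `G_{j+1}(Ω₂)Q^*` from the (I.2.24) engine `hH₂` for `Ω₂` (p35 g16's
`holder_G_avgQkAdj_cb_le_R`), the middle (I.2.34) for `Ω₂`, the right `Q·δG_{j+1}` from the (I.2.26) value engine `h26` (margin of `x_q`).
[cite: Balaban1983Higgs3, (2.6) p.424, (2.11) p.426] [cite: Balaban1982Higgs1, Prop. 2.1 (2.24)–(2.26) p.610, Prop. 2.3 (2.34) p.611] -/
theorem normH_T3_cb_le {j : ℕ} (hj : j + 1 ≤ P.K) (hsub : Ω₂ ⊆ Ω) (hmsq : 0 < msq) (ha : 0 < a) (hL : 1 < (P.L : ℝ))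
    (hΩ : ∀ x x' : HiggsLattice.Site P 0, blockIter (j + 1) x = blockIter (j + 1) x' → (x ∈ Ω ↔ x' ∈ Ω))
    (hΩ₂ : ∀ x x' : HiggsLattice.Site P 0, blockIter (j + 1) x = blockIter (j + 1) x' → (x ∈ Ω₂ ↔ x' ∈ Ω₂))
    (hΩ₂' : ∀ x x' : HiggsLattice.Site P 0, blockIter (j + 2) x = blockIter (j + 2) x' → (x ∈ Ω₂ ↔ x' ∈ Ω₂))
    {good : HiggsLattice.Site P 0 → Prop} (hgood₂ : ∀ x, good x → x ∈ Ω₂)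
    (hgood₂' : ∀ (x : HiggsLattice.Site P 0) (μ : Fin P.d), good x → x.shift μ ∈ Ω₂) {c26 cH₂ cC₂ δ : ℝ} (hc26 : 0 ≤ c26)
    (hcH₂ : 0 ≤ cH₂) (hcC₂ : 0 ≤ cC₂) (hδ : 0 < δ)
    (h26 : ∀ (g : ScalarField P 0 N) (M D D₀ : ℝ), (∀ x, ‖g x‖ ≤ M) → 0 ≤ D → 0 ≤ D₀ →
      ∀ x, good x → (∀ z, g z ≠ 0 → D ≤ (HiggsLattice.Site.tdist x z : ℝ)) → (∀ z, z ∉ Ω₂ → D₀ ≤ (HiggsLattice.Site.tdist x z : ℝ)) →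
        ‖dG C Ω Ω₂ A msq a (j + 1) g x‖ ≤ c26 * Real.exp (-(δ * ((D + D₀) / (P.L : ℝ) ^ (j + 1)))) * M)
    (hH₂ : ∀ (g : ScalarField P 0 N) (M D : ℝ), (∀ x, ‖g x‖ ≤ M) → 0 ≤ D →
      ∀ (μ : Fin P.d) (x x' : HiggsLattice.Site P 0), x' ≠ x → good x → good x' →
        ∀ Γ : List (HiggsLattice.Site P 0), IsTChain x Γ →
        pathEnd x Γ = x' → (Γ.length : ℝ) ≤ (P.d : ℝ) * HiggsLattice.Site.tdist x x' →
        (∀ z, g z ≠ 0 → D ≤ (HiggsLattice.Site.tdist x z : ℝ)) → (∀ z, g z ≠ 0 → D ≤ (HiggsLattice.Site.tdist x' z : ℝ)) →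
          (((HiggsLattice.Site.tdist x x' : ℝ) / (P.L : ℝ) ^ (j + 1))⁻¹) ^ α *
              ‖hol C A x Γ (covDeriv C A (propagatorK C Ω₂ A msq a (j + 1) g) ⟨x', μ⟩)
                - covDeriv C A (propagatorK C Ω₂ A msq a (j + 1) g) ⟨x, μ⟩‖
            ≤ cH₂ * Real.exp (-(δ * (D / (P.L : ℝ) ^ (j + 1)))) * M)
    (hC₂ : ∀ s t : HiggsLattice.Site P (j + 1) × Ix N, s.1 ∈ levelSet (j + 1) Ω₂ → t.1 ∈ levelSet (j + 1) Ω₂ →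
      |mat (fluctCovA C Ω₂ A msq a (j + 1)) s t| ≤ cC₂ * Real.exp (-(δ * (HiggsLattice.Site.tdist s.1 t.1 : ℝ))))
    {q : HiggsLattice.Site P 0 × Ix N} (hq : good q.1) (μ : Fin P.d) {x₁ x₂ : HiggsLattice.Site P 0} (hne : x₂ ≠ x₁)
    (hx₁ : good x₁) (hx₂ : good x₂) {Γ : List (HiggsLattice.Site P 0)} (hΓ : IsAdm x₁ x₂ Γ) :
    (((HiggsLattice.Site.tdist x₁ x₂ : ℝ) / (P.L : ℝ) ^ (j + 1))⁻¹) ^ α *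
        ‖hol C A x₁ Γ (covDeriv C A (T3 C Ω Ω₂ A msq a (j + 1) (cb P N 0 q)) ⟨x₂, μ⟩)
          - covDeriv C A (T3 C Ω Ω₂ A msq a (j + 1) (cb P N 0 q)) ⟨x₁, μ⟩‖
      ≤ (cH₂ * Real.exp δ * Real.sqrt N) * cC₂ *
          ((((P.L : ℝ) ^ (j + 1)) ^ P.d)⁻¹ * (c26 * Real.exp δ * Real.exp (-(δ * (distC Ω₂ q.1 / (P.L : ℝ) ^ (j + 1)))) *
            Real.sqrt N)) * (profile P N (δ / 2) ^ 2 * Real.exp (δ / 2)) *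
          (2 * Real.exp (-(δ / 2 * (min (HiggsLattice.Site.tdist x₁ q.1 : ℝ) (HiggsLattice.Site.tdist x₂ q.1 : ℝ) /
            (P.L : ℝ) ^ (j + 1))))) := by
  have hak : 0 ≤ B1.aSeq a P.L (j + 1) := (B1.aSeq_pos ha hL (by omega)).le
  have hW : 0 ≤ (((HiggsLattice.Site.tdist x₁ x₂ : ℝ) / (P.L : ℝ) ^ (j + 1))⁻¹) ^ α :=
    Real.rpow_nonneg (inv_nonneg.mpr (by positivity)) _
  unfold T3
  refine holderW_XYZ_cb_exp_le C A hj _ _ _ (levelSet (j + 1) Ω₂) (levelSet (j + 1) Ω) (by positivity) hcC₂ (by positivity) hδ hW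
    (fun s _ => ?_) (fun s hs => ?_) (fun s hs => ?_) (fun s t hs ht => ?_) (fun t _ => ?_) (fun t ht => ?_)
  · simp only [LinearMap.comp_apply]
    exact (holder_G_avgQkAdj_cb_le_R C Ω₂ A msq a hj hcH₂ hδ.le hH₂ s μ hne hx₁ hx₂ hΓ).trans (le_of_eq (by ring))
  · rw [LinearMap.comp_apply]
    exact covDeriv_G_avgQkAdj_cb_eq_zero C Ω₂ A msq a hmsq hak hΩ₂ s hs (hgood₂ _ hx₁) (hgood₂' _ μ hx₁)
  · rw [LinearMap.comp_apply]
    exact covDeriv_G_avgQkAdj_cb_eq_zero C Ω₂ A msq a hmsq hak hΩ₂ s hs (hgood₂ _ hx₂) (hgood₂' _ μ hx₂)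
  · by_cases ht₂ : t.1 ∈ levelSet (j + 1) Ω₂
    · exact hC₂ s t hs ht₂
    · rw [mat_fluctCovA_eq_zero_of_not_mem C Ω₂ A msq a hj hmsq ha hL hΩ₂ hΩ₂' hs ht₂, abs_zero]
      positivity
  · exact (abs_mat_QdG_le C Ω Ω₂ A msq a hj hc26 hδ.le (distC_nonneg Ω₂ q.1) h26 t hq
      (fun z hz => distC_le Ω₂ q.1 hz)).trans (le_of_eq (by ring))
  · exact mat_QdG_eq_zero C Ω Ω₂ A msq a hsub hmsq hak hΩ hΩ₂ t ht (hgood₂ _ hq)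

/-- **(T2), Hölder-transported** (level `l = j + 1`, `Ω₂ᶜ ≠ ∅`): the left kernel `G_{j+1}(Ω₂)Q^*` from the (I.2.24) engine `hH₂`, the
middle `δC^{(j+1)}` by (I.2.36) + (I.2.38) with the weight `dist(y_s, Ω₂^{(j+1)c})` (r14's `abs_mat_dC_le`) folded into the common margin `ρ`
of the two row points (`margin_le_of_levelSet` at `x₁` and at `x₂`), the right `Q·G_{j+1}(Ω)` by (I.2.25) — r14's `normD_T2_cb_le` from both row
points. [cite: Balaban1983Higgs3, (2.6) p.424, (2.11) p.426] [cite: Balaban1982Higgs1, Prop. 2.1 (2.24)–(2.25) p.610, (2.34), (2.36)–(2.38) pp.611–612] -/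
theorem normH_T2_cb_le {j : ℕ} (hj : j + 1 ≤ P.K) (hsub : Ω₂ ⊆ Ω) (hmsq : 0 < msq) (ha : 0 < a) (hL : 1 < (P.L : ℝ))
    (hΩ : ∀ x x' : HiggsLattice.Site P 0, blockIter (j + 1) x = blockIter (j + 1) x' → (x ∈ Ω ↔ x' ∈ Ω))
    (hΩ₂ : ∀ x x' : HiggsLattice.Site P 0, blockIter (j + 1) x = blockIter (j + 1) x' → (x ∈ Ω₂ ↔ x' ∈ Ω₂))
    (hΩ₂' : ∀ x x' : HiggsLattice.Site P 0, blockIter (j + 2) x = blockIter (j + 2) x' → (x ∈ Ω₂ ↔ x' ∈ Ω₂))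
    {z₀ : HiggsLattice.Site P 0} (hz₀ : z₀ ∉ Ω₂)
    {good : HiggsLattice.Site P 0 → Prop} (hgood₂ : ∀ x, good x → x ∈ Ω₂)
    (hgood₂' : ∀ (x : HiggsLattice.Site P 0) (μ : Fin P.d), good x → x.shift μ ∈ Ω₂) {cG cH₂ cY δ : ℝ} (hcG : 0 ≤ cG)
    (hcH₂ : 0 ≤ cH₂) (hcY : 0 ≤ cY) (hδ : 0 < δ)
    (hG : ∀ (g : ScalarField P 0 N) (M D : ℝ), (∀ x, ‖g x‖ ≤ M) → 0 ≤ D →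
      ∀ x, good x → (∀ z, g z ≠ 0 → D ≤ (HiggsLattice.Site.tdist x z : ℝ)) →
        ‖propagatorK C Ω A msq a (j + 1) g x‖ ≤ cG * Real.exp (-(δ * (D / (P.L : ℝ) ^ (j + 1)))) * M)
    (hH₂ : ∀ (g : ScalarField P 0 N) (M D : ℝ), (∀ x, ‖g x‖ ≤ M) → 0 ≤ D →
      ∀ (μ : Fin P.d) (x x' : HiggsLattice.Site P 0), x' ≠ x → good x → good x' →
        ∀ Γ : List (HiggsLattice.Site P 0), IsTChain x Γ →
        pathEnd x Γ = x' → (Γ.length : ℝ) ≤ (P.d : ℝ) * HiggsLattice.Site.tdist x x' →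
        (∀ z, g z ≠ 0 → D ≤ (HiggsLattice.Site.tdist x z : ℝ)) → (∀ z, g z ≠ 0 → D ≤ (HiggsLattice.Site.tdist x' z : ℝ)) →
          (((HiggsLattice.Site.tdist x x' : ℝ) / (P.L : ℝ) ^ (j + 1))⁻¹) ^ α *
              ‖hol C A x Γ (covDeriv C A (propagatorK C Ω₂ A msq a (j + 1) g) ⟨x', μ⟩)
                - covDeriv C A (propagatorK C Ω₂ A msq a (j + 1) g) ⟨x, μ⟩‖
            ≤ cH₂ * Real.exp (-(δ * (D / (P.L : ℝ) ^ (j + 1)))) * M)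
    (h36 : ∀ s t : HiggsLattice.Site P (j + 1) × Ix N, s.1 ∈ levelSet (j + 1) Ω₂ → t.1 ∈ levelSet (j + 1) Ω₂ →
      |mat (fluctCovA C Ω A msq a (j + 1)) s t - mat (condCov232 C Ω A msq a (j + 1) (levelSet (j + 1) Ω₂)) s t|
        ≤ cY * Real.exp (-(δ * ((HiggsLattice.Site.tdist s.1 t.1 : ℝ) + distC (levelSet (j + 1) Ω₂) s.1
            + distC (levelSet (j + 1) Ω₂) t.1))))
    (h38 : ∀ s t : HiggsLattice.Site P (j + 1) × Ix N, s.1 ∈ levelSet (j + 1) Ω₂ → t.1 ∈ levelSet (j + 1) Ω₂ →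
      |mat (condCov232 C Ω₂ A msq a (j + 1) (levelSet (j + 1) Ω₂)) s t
          - mat (condCov232 C Ω A msq a (j + 1) (levelSet (j + 1) Ω₂)) s t|
        ≤ cY * Real.exp (-(δ * ((HiggsLattice.Site.tdist s.1 t.1 : ℝ) + distC (levelSet (j + 1) Ω₂) s.1
            + distC (levelSet (j + 1) Ω₂) t.1))))
    (hC : ∀ s t : HiggsLattice.Site P (j + 1) × Ix N, s.1 ∈ levelSet (j + 1) Ω → t.1 ∈ levelSet (j + 1) Ω →
      |mat (fluctCovA C Ω A msq a (j + 1)) s t| ≤ cY * Real.exp (-(δ * (HiggsLattice.Site.tdist s.1 t.1 : ℝ))))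
    {q : HiggsLattice.Site P 0 × Ix N} (hq : good q.1) (μ : Fin P.d) {x₁ x₂ : HiggsLattice.Site P 0} (hne : x₂ ≠ x₁)
    (hx₁ : good x₁) (hx₂ : good x₂) {Γ : List (HiggsLattice.Site P 0)} (hΓ : IsAdm x₁ x₂ Γ) {ρ : ℝ}
    (hρ₁ : ∀ z, z ∉ Ω₂ → ρ ≤ (HiggsLattice.Site.tdist x₁ z : ℝ)) (hρ₂ : ∀ z, z ∉ Ω₂ → ρ ≤ (HiggsLattice.Site.tdist x₂ z : ℝ)) :
    (((HiggsLattice.Site.tdist x₁ x₂ : ℝ) / (P.L : ℝ) ^ (j + 1))⁻¹) ^ α *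
        ‖hol C A x₁ Γ (covDeriv C A (T2 C Ω Ω₂ A msq a (j + 1) (cb P N 0 q)) ⟨x₂, μ⟩)
          - covDeriv C A (T2 C Ω Ω₂ A msq a (j + 1) (cb P N 0 q)) ⟨x₁, μ⟩‖
      ≤ (cH₂ * Real.exp δ * Real.sqrt N) * (3 * cY) * ((((P.L : ℝ) ^ (j + 1)) ^ P.d)⁻¹ * (cG * Real.exp δ * Real.sqrt N)) *
          (Real.exp (δ / 2) * Real.exp (-(δ / 2 * (ρ / (P.L : ℝ) ^ (j + 1))))) *
          (profile P N (δ / 2 / 2) ^ 2 * Real.exp (δ / 2 / 2)) *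
          (2 * Real.exp (-(δ / 2 / 2 * (min (HiggsLattice.Site.tdist x₁ q.1 : ℝ) (HiggsLattice.Site.tdist x₂ q.1 : ℝ) /
            (P.L : ℝ) ^ (j + 1))))) := by
  have hak : 0 ≤ B1.aSeq a P.L (j + 1) := (B1.aSeq_pos ha hL (by omega)).le
  have hW : 0 ≤ (((HiggsLattice.Site.tdist x₁ x₂ : ℝ) / (P.L : ℝ) ^ (j + 1))⁻¹) ^ α :=
    Real.rpow_nonneg (inv_nonneg.mpr (by positivity)) _
  set u₁ := blockIter (j + 1) x₁ with hu₁
  set u₂ := blockIter (j + 1) x₂ with hu₂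
  set v := blockIter (j + 1) q.1 with hv
  set cX := cH₂ * Real.exp δ * Real.sqrt N with hcX
  set cZ := (((P.L : ℝ) ^ (j + 1)) ^ P.d)⁻¹ * (cG * Real.exp δ * Real.sqrt N) with hcZ
  have hcX0 : 0 ≤ cX := by positivity
  have hcZ0 : 0 ≤ cZ := by positivity
  -- domination with the weighted middle majorant, left kernel from both row points
  have hdom := holderW_XYZ_cb_le C A (propagatorK C Ω₂ A msq a (j + 1) ∘ₗ avgQkAdj C A (j + 1))
    (fluctCovA C Ω A msq a (j + 1) - fluctCovA C Ω₂ A msq a (j + 1)) (avgQkLin C A (j + 1) ∘ₗ propagatorK C Ω A msq a (j + 1))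
    (levelSet (j + 1) Ω₂) (levelSet (j + 1) Ω)
    (FX := fun s => cX * (Real.exp (-(δ * (HiggsLattice.Site.tdist u₁ s.1 : ℝ))) +
      Real.exp (-(δ * (HiggsLattice.Site.tdist u₂ s.1 : ℝ)))))
    (FY := fun s t => 3 * cY * Real.exp (-(δ / 2 * (HiggsLattice.Site.tdist s.1 t.1 : ℝ))) *
      Real.exp (-(δ / 2 * distC (levelSet (j + 1) Ω₂) s.1)))
    (FZ := fun t => cZ * Real.exp (-(δ * (HiggsLattice.Site.tdist v t.1 : ℝ))))
    (fun s => by positivity) (fun s t => by positivity) (fun t => by positivity) hW (q := q) (x₁ := x₁) (x₂ := x₂) (Γ := Γ) (μ := μ)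
    (fun s _ => by
      simp only [LinearMap.comp_apply]
      exact (holder_G_avgQkAdj_cb_le_R C Ω₂ A msq a hj hcH₂ hδ.le hH₂ s μ hne hx₁ hx₂ hΓ).trans
        (le_of_eq (by rw [hcX, hu₁, hu₂]; ring)))
    (fun s hs => by
      rw [LinearMap.comp_apply]
      exact covDeriv_G_avgQkAdj_cb_eq_zero C Ω₂ A msq a hmsq hak hΩ₂ s hs (hgood₂ _ hx₁) (hgood₂' _ μ hx₁))
    (fun s hs => by
      rw [LinearMap.comp_apply]
      exact covDeriv_G_avgQkAdj_cb_eq_zero C Ω₂ A msq a hmsq hak hΩ₂ s hs (hgood₂ _ hx₂) (hgood₂' _ μ hx₂))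
    (fun s t hs ht => abs_mat_dC_le C Ω Ω₂ A msq a hj hsub hmsq ha hL hΩ₂ hΩ₂' hcY hδ.le h36 h38 hC hs ht)
    (fun t _ => (abs_mat_QG_le_R C Ω A msq a hj hcG hδ.le hG t hq).trans (le_of_eq (by rw [hcZ, hv]; ring)))
    (fun t ht => mat_QG_eq_zero_R C Ω A msq a hmsq hak hΩ t ht (hsub (hgood₂ _ hq)))
  unfold T2
  refine hdom.trans ?_
  -- fold the weight into the common margin `ρ` (at `x₁` and at `x₂`), halve the rates, and sum twice
  have hLl : (0 : ℝ) < (P.L : ℝ) ^ (j + 1) := pow_pos (by linarith) _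
  have hmargin : ∀ (u : HiggsLattice.Site P (j + 1)) (x : HiggsLattice.Site P 0), u = blockIter (j + 1) x →
      (∀ z, z ∉ Ω₂ → ρ ≤ (HiggsLattice.Site.tdist x z : ℝ)) → ∀ s : HiggsLattice.Site P (j + 1) × Ix N,
      Real.exp (-(δ * (HiggsLattice.Site.tdist u s.1 : ℝ))) * Real.exp (-(δ / 2 * distC (levelSet (j + 1) Ω₂) s.1))
        ≤ (Real.exp (δ / 2) * Real.exp (-(δ / 2 * (ρ / (P.L : ℝ) ^ (j + 1))))) *
          Real.exp (-(δ / 2 * (HiggsLattice.Site.tdist u s.1 : ℝ))) := by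
    intro u x hux hρx s
    have hm := margin_le_of_levelSet Ω₂ hj hΩ₂ hz₀ (x := x) (ρ := ρ) hρx s.1
    rw [← hux] at hm
    have hkey : ρ / (P.L : ℝ) ^ (j + 1) - 1
        ≤ (HiggsLattice.Site.tdist u s.1 : ℝ) + distC (levelSet (j + 1) Ω₂) s.1 := by
      rw [sub_le_iff_le_add, div_le_iff₀ hLl]
      nlinarith
    rw [← Real.exp_add, ← Real.exp_add, ← Real.exp_add]
    apply Real.exp_le_exp.mpr
    nlinarith [mul_le_mul_of_nonneg_left hkey (by linarith : (0 : ℝ) ≤ δ / 2)]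
  have hK : 0 ≤ profile P N (δ / 2 / 2) := profile_nonneg' _ (by linarith)
  set Wm := Real.exp (δ / 2) * Real.exp (-(δ / 2 * (ρ / (P.L : ℝ) ^ (j + 1)))) with hWm
  have hWm0 : 0 ≤ Wm := by positivity
  -- termwise: split the two centres
  have hterm : ∀ s t : HiggsLattice.Site P (j + 1) × Ix N,
      cX * (Real.exp (-(δ * (HiggsLattice.Site.tdist u₁ s.1 : ℝ))) + Real.exp (-(δ * (HiggsLattice.Site.tdist u₂ s.1 : ℝ)))) *
          (3 * cY * Real.exp (-(δ / 2 * (HiggsLattice.Site.tdist s.1 t.1 : ℝ))) *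
            Real.exp (-(δ / 2 * distC (levelSet (j + 1) Ω₂) s.1))) *
          (cZ * Real.exp (-(δ * (HiggsLattice.Site.tdist v t.1 : ℝ))))
        ≤ (cX * (3 * cY) * cZ * Wm) *
            (Real.exp (-(δ / 2 * (HiggsLattice.Site.tdist u₁ s.1 : ℝ))) * Real.exp (-(δ / 2 * (HiggsLattice.Site.tdist s.1 t.1 : ℝ))) *
              Real.exp (-(δ / 2 * (HiggsLattice.Site.tdist v t.1 : ℝ)))) +
          (cX * (3 * cY) * cZ * Wm) *
            (Real.exp (-(δ / 2 * (HiggsLattice.Site.tdist u₂ s.1 : ℝ))) * Real.exp (-(δ / 2 * (HiggsLattice.Site.tdist s.1 t.1 : ℝ))) *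
              Real.exp (-(δ / 2 * (HiggsLattice.Site.tdist v t.1 : ℝ)))) := by
    intro s t
    have h1 := hmargin u₁ x₁ hu₁ hρ₁ s
    have h1' := hmargin u₂ x₂ hu₂ hρ₂ s
    have h2 : Real.exp (-(δ * (HiggsLattice.Site.tdist v t.1 : ℝ))) ≤ Real.exp (-(δ / 2 * (HiggsLattice.Site.tdist v t.1 : ℝ))) :=
      exp_le_exp_neg (by nlinarith [(Nat.cast_nonneg _ : (0 : ℝ) ≤ (HiggsLattice.Site.tdist v t.1 : ℝ))])
    have h3 : 0 ≤ Real.exp (-(δ / 2 * (HiggsLattice.Site.tdist s.1 t.1 : ℝ))) := (Real.exp_pos _).le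
    have hA : cX * Real.exp (-(δ * (HiggsLattice.Site.tdist u₁ s.1 : ℝ))) *
          (3 * cY * Real.exp (-(δ / 2 * (HiggsLattice.Site.tdist s.1 t.1 : ℝ))) *
            Real.exp (-(δ / 2 * distC (levelSet (j + 1) Ω₂) s.1))) *
          (cZ * Real.exp (-(δ * (HiggsLattice.Site.tdist v t.1 : ℝ))))
        ≤ (cX * (3 * cY) * cZ * Wm) *
            (Real.exp (-(δ / 2 * (HiggsLattice.Site.tdist u₁ s.1 : ℝ))) * Real.exp (-(δ / 2 * (HiggsLattice.Site.tdist s.1 t.1 : ℝ))) *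
              Real.exp (-(δ / 2 * (HiggsLattice.Site.tdist v t.1 : ℝ)))) := by
      calc cX * Real.exp (-(δ * (HiggsLattice.Site.tdist u₁ s.1 : ℝ))) *
            (3 * cY * Real.exp (-(δ / 2 * (HiggsLattice.Site.tdist s.1 t.1 : ℝ))) *
              Real.exp (-(δ / 2 * distC (levelSet (j + 1) Ω₂) s.1))) *
            (cZ * Real.exp (-(δ * (HiggsLattice.Site.tdist v t.1 : ℝ))))
          = (cX * (3 * cY) * cZ) * Real.exp (-(δ / 2 * (HiggsLattice.Site.tdist s.1 t.1 : ℝ))) *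
              ((Real.exp (-(δ * (HiggsLattice.Site.tdist u₁ s.1 : ℝ))) * Real.exp (-(δ / 2 * distC (levelSet (j + 1) Ω₂) s.1))) *
                Real.exp (-(δ * (HiggsLattice.Site.tdist v t.1 : ℝ)))) := by ring
        _ ≤ (cX * (3 * cY) * cZ) * Real.exp (-(δ / 2 * (HiggsLattice.Site.tdist s.1 t.1 : ℝ))) *
              ((Wm * Real.exp (-(δ / 2 * (HiggsLattice.Site.tdist u₁ s.1 : ℝ)))) *
                Real.exp (-(δ / 2 * (HiggsLattice.Site.tdist v t.1 : ℝ)))) :=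
            mul_le_mul_of_nonneg_left (mul_le_mul h1 h2 (Real.exp_pos _).le (by positivity)) (by positivity)
        _ = _ := by ring
    have hB : cX * Real.exp (-(δ * (HiggsLattice.Site.tdist u₂ s.1 : ℝ))) *
          (3 * cY * Real.exp (-(δ / 2 * (HiggsLattice.Site.tdist s.1 t.1 : ℝ))) *
            Real.exp (-(δ / 2 * distC (levelSet (j + 1) Ω₂) s.1))) *
          (cZ * Real.exp (-(δ * (HiggsLattice.Site.tdist v t.1 : ℝ))))
        ≤ (cX * (3 * cY) * cZ * Wm) *
            (Real.exp (-(δ / 2 * (HiggsLattice.Site.tdist u₂ s.1 : ℝ))) * Real.exp (-(δ / 2 * (HiggsLattice.Site.tdist s.1 t.1 : ℝ))) *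
              Real.exp (-(δ / 2 * (HiggsLattice.Site.tdist v t.1 : ℝ)))) := by
      calc cX * Real.exp (-(δ * (HiggsLattice.Site.tdist u₂ s.1 : ℝ))) *
            (3 * cY * Real.exp (-(δ / 2 * (HiggsLattice.Site.tdist s.1 t.1 : ℝ))) *
              Real.exp (-(δ / 2 * distC (levelSet (j + 1) Ω₂) s.1))) *
            (cZ * Real.exp (-(δ * (HiggsLattice.Site.tdist v t.1 : ℝ))))
          = (cX * (3 * cY) * cZ) * Real.exp (-(δ / 2 * (HiggsLattice.Site.tdist s.1 t.1 : ℝ))) *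
              ((Real.exp (-(δ * (HiggsLattice.Site.tdist u₂ s.1 : ℝ))) * Real.exp (-(δ / 2 * distC (levelSet (j + 1) Ω₂) s.1))) *
                Real.exp (-(δ * (HiggsLattice.Site.tdist v t.1 : ℝ)))) := by ring
        _ ≤ (cX * (3 * cY) * cZ) * Real.exp (-(δ / 2 * (HiggsLattice.Site.tdist s.1 t.1 : ℝ))) *
              ((Wm * Real.exp (-(δ / 2 * (HiggsLattice.Site.tdist u₂ s.1 : ℝ)))) *
                Real.exp (-(δ / 2 * (HiggsLattice.Site.tdist v t.1 : ℝ)))) :=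
            mul_le_mul_of_nonneg_left (mul_le_mul h1' h2 (Real.exp_pos _).le (by positivity)) (by positivity)
        _ = _ := by ring
    have hsplit : cX * (Real.exp (-(δ * (HiggsLattice.Site.tdist u₁ s.1 : ℝ))) + Real.exp (-(δ * (HiggsLattice.Site.tdist u₂ s.1 : ℝ)))) *
          (3 * cY * Real.exp (-(δ / 2 * (HiggsLattice.Site.tdist s.1 t.1 : ℝ))) *
            Real.exp (-(δ / 2 * distC (levelSet (j + 1) Ω₂) s.1))) *
          (cZ * Real.exp (-(δ * (HiggsLattice.Site.tdist v t.1 : ℝ))))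
        = cX * Real.exp (-(δ * (HiggsLattice.Site.tdist u₁ s.1 : ℝ))) *
          (3 * cY * Real.exp (-(δ / 2 * (HiggsLattice.Site.tdist s.1 t.1 : ℝ))) *
            Real.exp (-(δ / 2 * distC (levelSet (j + 1) Ω₂) s.1))) *
          (cZ * Real.exp (-(δ * (HiggsLattice.Site.tdist v t.1 : ℝ)))) +
          cX * Real.exp (-(δ * (HiggsLattice.Site.tdist u₂ s.1 : ℝ))) *
          (3 * cY * Real.exp (-(δ / 2 * (HiggsLattice.Site.tdist s.1 t.1 : ℝ))) *
            Real.exp (-(δ / 2 * distC (levelSet (j + 1) Ω₂) s.1))) *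
          (cZ * Real.exp (-(δ * (HiggsLattice.Site.tdist v t.1 : ℝ)))) := by ring
    rw [hsplit]
    exact add_le_add hA hB
  calc ∑ s : HiggsLattice.Site P (j + 1) × Ix N, ∑ t : HiggsLattice.Site P (j + 1) × Ix N,
          cX * (Real.exp (-(δ * (HiggsLattice.Site.tdist u₁ s.1 : ℝ))) + Real.exp (-(δ * (HiggsLattice.Site.tdist u₂ s.1 : ℝ)))) *
            (3 * cY * Real.exp (-(δ / 2 * (HiggsLattice.Site.tdist s.1 t.1 : ℝ))) *
              Real.exp (-(δ / 2 * distC (levelSet (j + 1) Ω₂) s.1))) *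
            (cZ * Real.exp (-(δ * (HiggsLattice.Site.tdist v t.1 : ℝ))))
      ≤ ∑ s : HiggsLattice.Site P (j + 1) × Ix N, ∑ t : HiggsLattice.Site P (j + 1) × Ix N,
          ((cX * (3 * cY) * cZ * Wm) *
            (Real.exp (-(δ / 2 * (HiggsLattice.Site.tdist u₁ s.1 : ℝ))) * Real.exp (-(δ / 2 * (HiggsLattice.Site.tdist s.1 t.1 : ℝ))) *
              Real.exp (-(δ / 2 * (HiggsLattice.Site.tdist v t.1 : ℝ)))) +
          (cX * (3 * cY) * cZ * Wm) *
            (Real.exp (-(δ / 2 * (HiggsLattice.Site.tdist u₂ s.1 : ℝ))) * Real.exp (-(δ / 2 * (HiggsLattice.Site.tdist s.1 t.1 : ℝ))) *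
              Real.exp (-(δ / 2 * (HiggsLattice.Site.tdist v t.1 : ℝ))))) :=
        Finset.sum_le_sum fun s _ => Finset.sum_le_sum fun t _ => hterm s t
    _ = (cX * (3 * cY) * cZ * Wm) * ((∑ s : HiggsLattice.Site P (j + 1) × Ix N, ∑ t : HiggsLattice.Site P (j + 1) × Ix N,
            Real.exp (-(δ / 2 * (HiggsLattice.Site.tdist u₁ s.1 : ℝ))) * Real.exp (-(δ / 2 * (HiggsLattice.Site.tdist s.1 t.1 : ℝ))) *
              Real.exp (-(δ / 2 * (HiggsLattice.Site.tdist v t.1 : ℝ)))) +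
          (∑ s : HiggsLattice.Site P (j + 1) × Ix N, ∑ t : HiggsLattice.Site P (j + 1) × Ix N,
            Real.exp (-(δ / 2 * (HiggsLattice.Site.tdist u₂ s.1 : ℝ))) * Real.exp (-(δ / 2 * (HiggsLattice.Site.tdist s.1 t.1 : ℝ))) *
              Real.exp (-(δ / 2 * (HiggsLattice.Site.tdist v t.1 : ℝ))))) := by
        rw [← Finset.sum_add_distrib, Finset.mul_sum]
        refine Finset.sum_congr rfl fun s _ => ?_
        rw [← Finset.sum_add_distrib, Finset.mul_sum]
        refine Finset.sum_congr rfl fun t _ => ?_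
        ring
    _ ≤ (cX * (3 * cY) * cZ * Wm) * (profile P N (δ / 2 / 2) ^ 2 *
          Real.exp (-(δ / 2 / 2 * (HiggsLattice.Site.tdist u₁ v : ℝ))) +
          profile P N (δ / 2 / 2) ^ 2 * Real.exp (-(δ / 2 / 2 * (HiggsLattice.Site.tdist u₂ v : ℝ)))) :=
        mul_le_mul_of_nonneg_left (add_le_add (sum3_le (by positivity) u₁ v q.2) (sum3_le (by positivity) u₂ v q.2)) (by positivity)
    _ ≤ (cX * (3 * cY) * cZ * Wm) * (profile P N (δ / 2 / 2) ^ 2 * (Real.exp (δ / 2 / 2) *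
          Real.exp (-(δ / 2 / 2 * ((HiggsLattice.Site.tdist x₁ q.1 : ℝ) / (P.L : ℝ) ^ (j + 1))))) +
          profile P N (δ / 2 / 2) ^ 2 * (Real.exp (δ / 2 / 2) *
          Real.exp (-(δ / 2 / 2 * ((HiggsLattice.Site.tdist x₂ q.1 : ℝ) / (P.L : ℝ) ^ (j + 1)))))) := by
        refine mul_le_mul_of_nonneg_left (add_le_add (mul_le_mul_of_nonneg_left ?_ (pow_nonneg hK 2))
          (mul_le_mul_of_nonneg_left ?_ (pow_nonneg hK 2))) (by positivity)
        · rw [hu₁, hv]; exact exp_blockIter_le hj (by positivity) x₁ q.1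
        · rw [hu₂, hv]; exact exp_blockIter_le hj (by positivity) x₂ q.1
    _ = (cX * (3 * cY) * cZ * Wm) * (profile P N (δ / 2 / 2) ^ 2 * Real.exp (δ / 2 / 2)) *
          (Real.exp (-(δ / 2 / 2 * ((HiggsLattice.Site.tdist x₁ q.1 : ℝ) / (P.L : ℝ) ^ (j + 1)))) +
            Real.exp (-(δ / 2 / 2 * ((HiggsLattice.Site.tdist x₂ q.1 : ℝ) / (P.L : ℝ) ^ (j + 1))))) := by ring
    _ ≤ (cX * (3 * cY) * cZ * Wm) * (profile P N (δ / 2 / 2) ^ 2 * Real.exp (δ / 2 / 2)) *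
          (2 * Real.exp (-(δ / 2 / 2 * (min (HiggsLattice.Site.tdist x₁ q.1 : ℝ) (HiggsLattice.Site.tdist x₂ q.1 : ℝ) /
            (P.L : ℝ) ^ (j + 1))))) := by
        refine mul_le_mul_of_nonneg_left ?_ (by positivity)
        rw [← min_div_div_right hLl.le]
        exact add_exp_le_two_exp_min (by positivity) _ _
    _ = _ := by rw [hcX, hcZ, hWm]

end Terms

/-! ## §3 The Hölder term of a δ-piece, the joint weight, and the δ-pieces bounded at interior points of `Ω₂` -/

section PieceBounds

variable (C : ChargeData N) (Ω Ω₂ : Finset (HiggsLattice.Site P 0)) (A : HiggsLattice.VecField P 0) (msq : ℝ) {a : ℝ} {α : ℝ}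

/-- **The transported Hölder term of the δ-piece `j` along the contour `Γ`** (the summand of the third part of (1.32) for `δG_k`, before the
weight): `ε^{−d}Σ_{i′}‖U(A(Γ))(D^ε_{A,μ}δpiece_j e_{(x′,i′)})(⟨x₂,μ⟩) − (D^ε_{A,μ}δpiece_j e_{(x′,i′)})(⟨x₁,μ⟩)‖` (p35 g16's `holderTermR` for the
δ-pieces). [cite: Balaban1983Higgs3, (2.5) p.424, (2.11) p.426, (1.32) p.420] -/
def dHolderTerm (a : ℝ) (k j : ℕ) (μ : Fin P.d) (x₁ x₂ x' : HiggsLattice.Site P 0) (Γ : List (HiggsLattice.Site P 0)) : ℝ :=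
  (P.mesh 0 ^ P.d)⁻¹ * ∑ i' : Ix N,
    ‖hol C A x₁ Γ (covDeriv C A (dPiece C Ω Ω₂ A msq a k j (cb P N 0 (x', i'))) ⟨x₂, μ⟩)
      - covDeriv C A (dPiece C Ω Ω₂ A msq a k j (cb P N 0 (x', i'))) ⟨x₁, μ⟩‖

/-- `dHolderTerm ≥ 0`. [cite: Balaban1983Higgs3, (2.11) p.426] -/
theorem dHolderTerm_nonneg {k j : ℕ} (μ : Fin P.d) (x₁ x₂ x' : HiggsLattice.Site P 0) (Γ : List (HiggsLattice.Site P 0)) :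
    0 ≤ dHolderTerm C Ω Ω₂ A msq a k j μ x₁ x₂ x' Γ :=
  mul_nonneg (inv_nonneg.mpr (pow_nonneg (P.mesh_pos 0).le _)) (Finset.sum_nonneg fun _ _ => norm_nonneg _)

/-- **The joint weight of the Hölder bounds**: `e^{−γ·m/T}·e^{−γ·min(|x₁−x′|,|x₂−x′|)/T}` with `m = min(dist(x₁,Ω₂ᶜ), dist(x₂,Ω₂ᶜ), dist(x′,Ω₂ᶜ))`
— the boundary factor of (2.5)/(I.2.26) in the minimum of the three margins, the decay of (2.11) from the pair `{x₁,x₂}`.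
[cite: Balaban1983Higgs3, (2.5) p.424, (2.11) p.426] -/
def hwgt (Ω₂ : Finset (HiggsLattice.Site P 0)) (γ T : ℝ) (x₁ x₂ x' : HiggsLattice.Site P 0) : ℝ :=
  Real.exp (-(γ * (min (min (distC Ω₂ x₁) (distC Ω₂ x₂)) (distC Ω₂ x') / T))) *
    Real.exp (-(γ * (min (HiggsLattice.Site.tdist x₁ x' : ℝ) (HiggsLattice.Site.tdist x₂ x' : ℝ) / T)))

/-- the joint weight is non-negative. [cite: Balaban1983Higgs3, (2.5) p.424] -/
theorem hwgt_nonneg (γ T : ℝ) (x₁ x₂ x' : HiggsLattice.Site P 0) : 0 ≤ hwgt Ω₂ γ T x₁ x₂ x' := by unfold hwgt; positivity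

variable {Ω₂} in
/-- a margin factor at a margin `≥ m` and a pair-decay factor, both at rates `≥ γ`, are below the joint weight at rate `γ`. [folklore] -/
private theorem exp_pair_le_hwgt {γ γ₁ γ₂ am T : ℝ} {x₁ x₂ x' : HiggsLattice.Site P 0} (hT : 0 < T) (hγ : 0 ≤ γ) (h₁ : γ ≤ γ₁)
    (h₂ : γ ≤ γ₂) (ham0 : 0 ≤ am) (ham : min (min (distC Ω₂ x₁) (distC Ω₂ x₂)) (distC Ω₂ x') ≤ am) :
    Real.exp (-(γ₁ * (am / T))) *
        Real.exp (-(γ₂ * (min (HiggsLattice.Site.tdist x₁ x' : ℝ) (HiggsLattice.Site.tdist x₂ x' : ℝ) / T)))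
      ≤ hwgt Ω₂ γ T x₁ x₂ x' := by
  unfold hwgt
  have hd0 : 0 ≤ min (HiggsLattice.Site.tdist x₁ x' : ℝ) (HiggsLattice.Site.tdist x₂ x' : ℝ) / T :=
    div_nonneg (le_min (Nat.cast_nonneg _) (Nat.cast_nonneg _)) hT.le
  refine mul_le_mul ?_ (exp_rate_le h₂ hd0) (Real.exp_pos _).le (Real.exp_pos _).le
  apply Real.exp_le_exp.mpr
  apply neg_le_neg
  calc γ * (min (min (distC Ω₂ x₁) (distC Ω₂ x₂)) (distC Ω₂ x') / T) ≤ γ * (am / T) :=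
        mul_le_mul_of_nonneg_left (div_le_div_of_nonneg_right ham hT.le) hγ
    _ ≤ γ₁ * (am / T) := mul_le_mul_of_nonneg_right h₁ (div_nonneg ham0 hT.le)

/-- `ε^{−d}·L^{−jd} = (L^jε)^{−d}`. [folklore] -/
private theorem inv_mesh_zero_pow_mul (j : ℕ) :
    (P.mesh 0 ^ P.d)⁻¹ * (((P.L : ℝ) ^ j) ^ P.d)⁻¹ = (P.mesh j ^ P.d)⁻¹ := by
  rw [mesh_eq_pow_mul P j, mul_pow, mul_inv, mul_comm]

/-- the transported difference of `c•(u₁+u₂+u₃)` against `c•(v₁+v₂+v₃)` splits term by term. [folklore] -/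
private theorem hol_smul_add3_sub (f : E N →L[ℝ] E N) (c : ℝ) (u₁ u₂ u₃ v₁ v₂ v₃ : E N) :
    f (c • (u₁ + u₂ + u₃)) - c • (v₁ + v₂ + v₃) = c • ((f u₁ - v₁) + (f u₂ - v₂) + (f u₃ - v₃)) := by
  simp only [map_smul, map_add, smul_add, smul_sub]
  abel

set_option maxHeartbeats 1600000 in
/-- **THE δ-PIECE `1 ≤ j+1 < k`, HÖLDER-TRANSPORTED, AT INTERIOR ROW POINTS `x₁ ≠ x₂` AND INTERIOR SOURCE `x′`** (`Ω₂ᶜ ≠ ∅`): the value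
inputs of r14's `absG_dPiece_pos_le` ((I.2.25) for both regions `hG`/`hG₂` are not both needed — `hG` for `Ω`, (I.2.26) value `h26`,
(I.2.34) `hC`/`hC₂`, (I.2.36) `h36`, (I.2.38) `h38`) plus the HÖLDER engines (I.2.26)″ for the pair (`h26H`, constant `c₂·L^{j+1}ε`) and
(I.2.24) for `Ω₂` (`hH₂`, constant `c₀·L^{j+1}ε`), all at the common rate `δ`:
`(|x₁−x₂|/L^{j+1})^{−α}·ε^{−d}Σ_{i′}‖U(A(Γ))(D^ε_Aδpiece_{j+1}e_{(x′,i′)})(⟨x₂,μ⟩) − (D^ε_Aδpiece_{j+1}e_{(x′,i′)})(⟨x₁,μ⟩)‖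
 ≤ N·a²·2k_T·(L^{j+1}ε)(L^{j+1}ε)^{−d}·e^{−(δ/4)m/L^{j+1}}e^{−(δ/4)min(|x₁−x′|,|x₂−x′|)/L^{j+1}}`.
[cite: Balaban1983Higgs3, (2.6) p.424, (2.11) p.426, (2.5) p.424] [cite: Balaban1982Higgs1, Prop. 2.1 (2.24)–(2.26) p.610, Prop. 2.3 (2.34)–(2.38) pp.611–612] -/
theorem absH_dPiece_pos_le {k j : ℕ} (hjk : j + 1 < k) (hjK : j + 1 ≤ P.K) (hsub : Ω₂ ⊆ Ω) (hmsq : 0 < msq) (ha : 0 < a)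
    (hL1 : 1 < P.L)
    (hΩ : ∀ x x' : HiggsLattice.Site P 0, blockIter (j + 1) x = blockIter (j + 1) x' → (x ∈ Ω ↔ x' ∈ Ω))
    (hΩ₂ : ∀ x x' : HiggsLattice.Site P 0, blockIter (j + 1) x = blockIter (j + 1) x' → (x ∈ Ω₂ ↔ x' ∈ Ω₂))
    (hΩ₂' : ∀ x x' : HiggsLattice.Site P 0, blockIter (j + 2) x = blockIter (j + 2) x' → (x ∈ Ω₂ ↔ x' ∈ Ω₂))
    {z₀ : HiggsLattice.Site P 0} (hz₀ : z₀ ∉ Ω₂)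
    {good : HiggsLattice.Site P 0 → Prop} (hgood₂ : ∀ x, good x → x ∈ Ω₂)
    (hgood₂' : ∀ (x : HiggsLattice.Site P 0) (μ : Fin P.d), good x → x.shift μ ∈ Ω₂) {c₀ c₁ c₂ δ : ℝ} (hc₀ : 0 ≤ c₀)
    (hc₁ : 0 ≤ c₁) (hc₂ : 0 ≤ c₂) (hδ : 0 < δ)
    (h26 : ∀ (g : ScalarField P 0 N) (M D D₀ : ℝ), (∀ x, ‖g x‖ ≤ M) → 0 ≤ D → 0 ≤ D₀ →
      ∀ x, good x → (∀ z, g z ≠ 0 → D ≤ (HiggsLattice.Site.tdist x z : ℝ)) → (∀ z, z ∉ Ω₂ → D₀ ≤ (HiggsLattice.Site.tdist x z : ℝ)) →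
        ‖dG C Ω Ω₂ A msq a (j + 1) g x‖ ≤ c₂ * P.mesh (j + 1) ^ 2 * Real.exp (-(δ * ((D + D₀) / (P.L : ℝ) ^ (j + 1)))) * M)
    (h26H : ∀ (g : ScalarField P 0 N) (M D D₀ : ℝ), (∀ x, ‖g x‖ ≤ M) → 0 ≤ D → 0 ≤ D₀ →
      ∀ (μ : Fin P.d) (x x' : HiggsLattice.Site P 0), x' ≠ x → good x → good x' →
        ∀ Γ : List (HiggsLattice.Site P 0), IsTChain x Γ → pathEnd x Γ = x' → (Γ.length : ℝ) ≤ (P.d : ℝ) * HiggsLattice.Site.tdist x x' →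
        (∀ z, g z ≠ 0 → D ≤ (HiggsLattice.Site.tdist x z : ℝ)) → (∀ z, g z ≠ 0 → D ≤ (HiggsLattice.Site.tdist x' z : ℝ)) →
        (∀ z, z ∉ Ω₂ → D₀ ≤ (HiggsLattice.Site.tdist x z : ℝ)) → (∀ z, z ∉ Ω₂ → D₀ ≤ (HiggsLattice.Site.tdist x' z : ℝ)) →
          (((HiggsLattice.Site.tdist x x' : ℝ) / (P.L : ℝ) ^ (j + 1))⁻¹) ^ α *
              ‖hol C A x Γ (covDeriv C A (dG C Ω Ω₂ A msq a (j + 1) g) ⟨x', μ⟩) - covDeriv C A (dG C Ω Ω₂ A msq a (j + 1) g) ⟨x, μ⟩‖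
            ≤ c₂ * P.mesh (j + 1) * Real.exp (-(δ * ((D + D₀) / (P.L : ℝ) ^ (j + 1)))) * M)
    (hG : ∀ (g : ScalarField P 0 N) (M D : ℝ), (∀ x, ‖g x‖ ≤ M) → 0 ≤ D →
      ∀ x, good x → (∀ z, g z ≠ 0 → D ≤ (HiggsLattice.Site.tdist x z : ℝ)) →
        ‖propagatorK C Ω A msq a (j + 1) g x‖ ≤ c₀ * P.mesh (j + 1) ^ 2 * Real.exp (-(δ * (D / (P.L : ℝ) ^ (j + 1)))) * M)
    (hH₂ : ∀ (g : ScalarField P 0 N) (M D : ℝ), (∀ x, ‖g x‖ ≤ M) → 0 ≤ D →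
      ∀ (μ : Fin P.d) (x x' : HiggsLattice.Site P 0), x' ≠ x → good x → good x' →
        ∀ Γ : List (HiggsLattice.Site P 0), IsTChain x Γ →
        pathEnd x Γ = x' → (Γ.length : ℝ) ≤ (P.d : ℝ) * HiggsLattice.Site.tdist x x' →
        (∀ z, g z ≠ 0 → D ≤ (HiggsLattice.Site.tdist x z : ℝ)) → (∀ z, g z ≠ 0 → D ≤ (HiggsLattice.Site.tdist x' z : ℝ)) →
          (((HiggsLattice.Site.tdist x x' : ℝ) / (P.L : ℝ) ^ (j + 1))⁻¹) ^ α *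
              ‖hol C A x Γ (covDeriv C A (propagatorK C Ω₂ A msq a (j + 1) g) ⟨x', μ⟩)
                - covDeriv C A (propagatorK C Ω₂ A msq a (j + 1) g) ⟨x, μ⟩‖
            ≤ c₀ * P.mesh (j + 1) * Real.exp (-(δ * (D / (P.L : ℝ) ^ (j + 1)))) * M)
    (hC : ∀ s t : HiggsLattice.Site P (j + 1) × Ix N, s.1 ∈ levelSet (j + 1) Ω → t.1 ∈ levelSet (j + 1) Ω →
      |mat (fluctCovA C Ω A msq a (j + 1)) s t| ≤ c₁ * P.mesh (j + 1) ^ 2 * Real.exp (-(δ * (HiggsLattice.Site.tdist s.1 t.1 : ℝ))))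
    (hC₂ : ∀ s t : HiggsLattice.Site P (j + 1) × Ix N, s.1 ∈ levelSet (j + 1) Ω₂ → t.1 ∈ levelSet (j + 1) Ω₂ →
      |mat (fluctCovA C Ω₂ A msq a (j + 1)) s t| ≤ c₁ * P.mesh (j + 1) ^ 2 * Real.exp (-(δ * (HiggsLattice.Site.tdist s.1 t.1 : ℝ))))
    (h36 : ∀ s t : HiggsLattice.Site P (j + 1) × Ix N, s.1 ∈ levelSet (j + 1) Ω₂ → t.1 ∈ levelSet (j + 1) Ω₂ →
      |mat (fluctCovA C Ω A msq a (j + 1)) s t - mat (condCov232 C Ω A msq a (j + 1) (levelSet (j + 1) Ω₂)) s t|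
        ≤ c₁ * P.mesh (j + 1) ^ 2 * Real.exp (-(δ * ((HiggsLattice.Site.tdist s.1 t.1 : ℝ) + distC (levelSet (j + 1) Ω₂) s.1
            + distC (levelSet (j + 1) Ω₂) t.1))))
    (h38 : ∀ s t : HiggsLattice.Site P (j + 1) × Ix N, s.1 ∈ levelSet (j + 1) Ω₂ → t.1 ∈ levelSet (j + 1) Ω₂ →
      |mat (condCov232 C Ω₂ A msq a (j + 1) (levelSet (j + 1) Ω₂)) s t
          - mat (condCov232 C Ω A msq a (j + 1) (levelSet (j + 1) Ω₂)) s t|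
        ≤ c₁ * P.mesh (j + 1) ^ 2 * Real.exp (-(δ * ((HiggsLattice.Site.tdist s.1 t.1 : ℝ) + distC (levelSet (j + 1) Ω₂) s.1
            + distC (levelSet (j + 1) Ω₂) t.1))))
    (μ : Fin P.d) {x₁ x₂ x' : HiggsLattice.Site P 0} (hne : x₂ ≠ x₁) (hx₁ : good x₁) (hx₂ : good x₂) (hx' : good x')
    {Γ : List (HiggsLattice.Site P 0)} (hΓ : IsAdm x₁ x₂ Γ) :
    (((HiggsLattice.Site.tdist x₁ x₂ : ℝ) / (P.L : ℝ) ^ (j + 1))⁻¹) ^ α * dHolderTerm C Ω Ω₂ A msq a k (j + 1) μ x₁ x₂ x' Γ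
      ≤ ((N : ℝ) * a ^ 2 * (2 * kT N c₀ c₁ c₂ δ (profile P N (δ / 2)) (profile P N (δ / 2 / 2)))) *
        (P.mesh (j + 1) * (P.mesh (j + 1) ^ P.d)⁻¹) * hwgt Ω₂ (δ / 4) ((P.L : ℝ) ^ (j + 1)) x₁ x₂ x' := by
  have hLr : 1 < (P.L : ℝ) := by exact_mod_cast hL1
  have hm : 0 < P.mesh (j + 1) := P.mesh_pos _
  have hT : (0 : ℝ) < (P.L : ℝ) ^ (j + 1) := pow_pos (by exact_mod_cast P.hL) _
  set W : ℝ := (((HiggsLattice.Site.tdist x₁ x₂ : ℝ) / (P.L : ℝ) ^ (j + 1))⁻¹) ^ α with hWdef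
  have hW0 : 0 ≤ W := Real.rpow_nonneg (inv_nonneg.mpr (by positivity)) _
  set Hw : ℝ := hwgt Ω₂ (δ / 4) ((P.L : ℝ) ^ (j + 1)) x₁ x₂ x' with hHw
  have hHw0 : 0 ≤ Hw := hwgt_nonneg Ω₂ _ _ _ _ _
  have hK₂0 : 0 ≤ profile P N (δ / 2) := profile_nonneg' _ (by positivity)
  have hK₄0 : 0 ≤ profile P N (δ / 2 / 2) := profile_nonneg' _ (by positivity)
  -- the common margin of the two row points and the margin of the source
  set am : ℝ := min (distC Ω₂ x₁) (distC Ω₂ x₂) with ham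
  have ham0 : 0 ≤ am := le_min (distC_nonneg _ _) (distC_nonneg _ _)
  have hρ₁ : ∀ z, z ∉ Ω₂ → am ≤ (HiggsLattice.Site.tdist x₁ z : ℝ) := fun z hz => (min_le_left _ _).trans (distC_le Ω₂ x₁ hz)
  have hρ₂ : ∀ z, z ∉ Ω₂ → am ≤ (HiggsLattice.Site.tdist x₂ z : ℝ) := fun z hz => (min_le_right _ _).trans (distC_le Ω₂ x₂ hz)
  have hmin3a : min (min (distC Ω₂ x₁) (distC Ω₂ x₂)) (distC Ω₂ x') ≤ am := min_le_left _ _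
  have hmin3b : min (min (distC Ω₂ x₁) (distC Ω₂ x₂)) (distC Ω₂ x') ≤ distC Ω₂ x' := min_le_right _ _
  set dm : ℝ := min (HiggsLattice.Site.tdist x₁ x' : ℝ) (HiggsLattice.Site.tdist x₂ x' : ℝ) with hdm
  have hsq : Real.sqrt (N : ℝ) * Real.sqrt N = N := Real.mul_self_sqrt (Nat.cast_nonneg _)
  -- the three terms with the joint weight
  have hT1 : ∀ i' : Ix N, W * ‖hol C A x₁ Γ (covDeriv C A (T1 C Ω Ω₂ A msq a (j + 1) (cb P N 0 (x', i'))) ⟨x₂, μ⟩)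
        - covDeriv C A (T1 C Ω Ω₂ A msq a (j + 1) (cb P N 0 (x', i'))) ⟨x₁, μ⟩‖
      ≤ (c₀ * c₁ * c₂ * N * Real.exp δ ^ 2 * (profile P N (δ / 2) ^ 2 * Real.exp (δ / 2))) *
          (2 * (P.mesh (j + 1) ^ 5 * (((P.L : ℝ) ^ (j + 1)) ^ P.d)⁻¹)) * Hw := by
    intro i'
    have h := normH_T1_cb_le C Ω Ω₂ A msq a hjK hsub hmsq (B1.aSeq_pos ha hLr (by omega)).le hΩ hΩ₂ hgood₂ hgood₂'
      (c26 := c₂ * P.mesh (j + 1)) (cG := c₀ * P.mesh (j + 1) ^ 2) (cC := c₁ * P.mesh (j + 1) ^ 2) (by positivity) (by positivity)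
      (by positivity) hδ h26H hG hC (q := (x', i')) hx' μ hne hx₁ hx₂ hΓ ham0 hρ₁ hρ₂
    refine h.trans ?_
    have hw : Real.exp (-(δ * (am / (P.L : ℝ) ^ (j + 1)))) * Real.exp (-(δ / 2 * (dm / (P.L : ℝ) ^ (j + 1)))) ≤ Hw := by
      rw [hHw]; exact exp_pair_le_hwgt hT (by positivity) (by linarith) (by linarith) ham0 hmin3a
    calc (c₂ * P.mesh (j + 1) * Real.exp δ * Real.exp (-(δ * (am / (P.L : ℝ) ^ (j + 1)))) * Real.sqrt N) * (c₁ * P.mesh (j + 1) ^ 2) *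
          ((((P.L : ℝ) ^ (j + 1)) ^ P.d)⁻¹ * (c₀ * P.mesh (j + 1) ^ 2 * Real.exp δ * Real.sqrt N)) *
          (profile P N (δ / 2) ^ 2 * Real.exp (δ / 2)) * (2 * Real.exp (-(δ / 2 * (dm / (P.L : ℝ) ^ (j + 1)))))
        = (c₀ * c₁ * c₂ * (Real.sqrt N * Real.sqrt N) * Real.exp δ ^ 2 * (profile P N (δ / 2) ^ 2 * Real.exp (δ / 2))) *
            (2 * (P.mesh (j + 1) ^ 5 * (((P.L : ℝ) ^ (j + 1)) ^ P.d)⁻¹)) *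
            (Real.exp (-(δ * (am / (P.L : ℝ) ^ (j + 1)))) * Real.exp (-(δ / 2 * (dm / (P.L : ℝ) ^ (j + 1))))) := by ring
      _ ≤ _ := by rw [hsq]; exact mul_le_mul_of_nonneg_left hw (by positivity)
  have hT3 : ∀ i' : Ix N, W * ‖hol C A x₁ Γ (covDeriv C A (T3 C Ω Ω₂ A msq a (j + 1) (cb P N 0 (x', i'))) ⟨x₂, μ⟩)
        - covDeriv C A (T3 C Ω Ω₂ A msq a (j + 1) (cb P N 0 (x', i'))) ⟨x₁, μ⟩‖
      ≤ (c₀ * c₁ * c₂ * N * Real.exp δ ^ 2 * (profile P N (δ / 2) ^ 2 * Real.exp (δ / 2))) *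
          (2 * (P.mesh (j + 1) ^ 5 * (((P.L : ℝ) ^ (j + 1)) ^ P.d)⁻¹)) * Hw := by
    intro i'
    have h := normH_T3_cb_le C Ω Ω₂ A msq a hjK hsub hmsq ha hLr hΩ hΩ₂ hΩ₂' hgood₂ hgood₂'
      (c26 := c₂ * P.mesh (j + 1) ^ 2) (cH₂ := c₀ * P.mesh (j + 1)) (cC₂ := c₁ * P.mesh (j + 1) ^ 2) (by positivity) (by positivity)
      (by positivity) hδ h26 hH₂ hC₂ (q := (x', i')) hx' μ hne hx₁ hx₂ hΓ
    refine h.trans ?_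
    have hw : Real.exp (-(δ * (distC Ω₂ x' / (P.L : ℝ) ^ (j + 1)))) * Real.exp (-(δ / 2 * (dm / (P.L : ℝ) ^ (j + 1)))) ≤ Hw := by
      rw [hHw]; exact exp_pair_le_hwgt hT (by positivity) (by linarith) (by linarith) (distC_nonneg _ _) hmin3b
    calc (c₀ * P.mesh (j + 1) * Real.exp δ * Real.sqrt N) * (c₁ * P.mesh (j + 1) ^ 2) *
          ((((P.L : ℝ) ^ (j + 1)) ^ P.d)⁻¹ * (c₂ * P.mesh (j + 1) ^ 2 * Real.exp δ *
            Real.exp (-(δ * (distC Ω₂ x' / (P.L : ℝ) ^ (j + 1)))) * Real.sqrt N)) *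
          (profile P N (δ / 2) ^ 2 * Real.exp (δ / 2)) * (2 * Real.exp (-(δ / 2 * (dm / (P.L : ℝ) ^ (j + 1)))))
        = (c₀ * c₁ * c₂ * (Real.sqrt N * Real.sqrt N) * Real.exp δ ^ 2 * (profile P N (δ / 2) ^ 2 * Real.exp (δ / 2))) *
            (2 * (P.mesh (j + 1) ^ 5 * (((P.L : ℝ) ^ (j + 1)) ^ P.d)⁻¹)) *
            (Real.exp (-(δ * (distC Ω₂ x' / (P.L : ℝ) ^ (j + 1)))) * Real.exp (-(δ / 2 * (dm / (P.L : ℝ) ^ (j + 1))))) := by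
          ring
      _ ≤ _ := by rw [hsq]; exact mul_le_mul_of_nonneg_left hw (by positivity)
  have hT2 : ∀ i' : Ix N, W * ‖hol C A x₁ Γ (covDeriv C A (T2 C Ω Ω₂ A msq a (j + 1) (cb P N 0 (x', i'))) ⟨x₂, μ⟩)
        - covDeriv C A (T2 C Ω Ω₂ A msq a (j + 1) (cb P N 0 (x', i'))) ⟨x₁, μ⟩‖
      ≤ (c₀ ^ 2 * c₁ * N * Real.exp δ ^ 2 * Real.exp (δ / 2) * (profile P N (δ / 2 / 2) ^ 2 * Real.exp (δ / 2 / 2))) *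
          (3 * (2 * (P.mesh (j + 1) ^ 5 * (((P.L : ℝ) ^ (j + 1)) ^ P.d)⁻¹))) * Hw := by
    intro i'
    have h := normH_T2_cb_le C Ω Ω₂ A msq a hjK hsub hmsq ha hLr hΩ hΩ₂ hΩ₂' hz₀ hgood₂ hgood₂'
      (cG := c₀ * P.mesh (j + 1) ^ 2) (cH₂ := c₀ * P.mesh (j + 1)) (cY := c₁ * P.mesh (j + 1) ^ 2) (by positivity) (by positivity)
      (by positivity) hδ hG hH₂ h36 h38 hC (q := (x', i')) hx' μ hne hx₁ hx₂ hΓ hρ₁ hρ₂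
    refine h.trans ?_
    have hw : Real.exp (-(δ / 2 * (am / (P.L : ℝ) ^ (j + 1)))) * Real.exp (-(δ / 2 / 2 * (dm / (P.L : ℝ) ^ (j + 1)))) ≤ Hw := by
      rw [hHw]; exact exp_pair_le_hwgt hT (by positivity) (by linarith) (by linarith) ham0 hmin3a
    calc (c₀ * P.mesh (j + 1) * Real.exp δ * Real.sqrt N) * (3 * (c₁ * P.mesh (j + 1) ^ 2)) *
          ((((P.L : ℝ) ^ (j + 1)) ^ P.d)⁻¹ * (c₀ * P.mesh (j + 1) ^ 2 * Real.exp δ * Real.sqrt N)) *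
          (Real.exp (δ / 2) * Real.exp (-(δ / 2 * (am / (P.L : ℝ) ^ (j + 1))))) *
          (profile P N (δ / 2 / 2) ^ 2 * Real.exp (δ / 2 / 2)) * (2 * Real.exp (-(δ / 2 / 2 * (dm / (P.L : ℝ) ^ (j + 1)))))
        = (c₀ ^ 2 * c₁ * (Real.sqrt N * Real.sqrt N) * Real.exp δ ^ 2 * Real.exp (δ / 2) *
            (profile P N (δ / 2 / 2) ^ 2 * Real.exp (δ / 2 / 2))) * (3 * (2 * (P.mesh (j + 1) ^ 5 * (((P.L : ℝ) ^ (j + 1)) ^ P.d)⁻¹))) *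
            (Real.exp (-(δ / 2 * (am / (P.L : ℝ) ^ (j + 1)))) * Real.exp (-(δ / 2 / 2 * (dm / (P.L : ℝ) ^ (j + 1))))) := by ring
      _ ≤ _ := by rw [hsq]; exact mul_le_mul_of_nonneg_left hw (by positivity)
  -- the δ-piece: `a_j²(L^jε)^{−4}(T1 + T2 + T3)`, transported difference term by term
  have hpiece : ∀ i' : Ix N, W * ‖hol C A x₁ Γ (covDeriv C A (dPiece C Ω Ω₂ A msq a k (j + 1) (cb P N 0 (x', i'))) ⟨x₂, μ⟩)
        - covDeriv C A (dPiece C Ω Ω₂ A msq a k (j + 1) (cb P N 0 (x', i'))) ⟨x₁, μ⟩‖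
      ≤ coeff221 P a (j + 1) ^ 2 * ((2 * kT N c₀ c₁ c₂ δ (profile P N (δ / 2)) (profile P N (δ / 2 / 2))) *
          (P.mesh (j + 1) ^ 5 * (((P.L : ℝ) ^ (j + 1)) ^ P.d)⁻¹) * Hw) := by
    intro i'
    rw [dPiece_of_pos (by omega) hjk, LinearMap.smul_apply, covDeriv_smul'', covDeriv_smul'', LinearMap.add_apply,
      LinearMap.add_apply, covDeriv_add'', covDeriv_add'', covDeriv_add'', covDeriv_add'', hol_smul_add3_sub, norm_smul,
      Real.norm_eq_abs, abs_of_nonneg (sq_nonneg _), ← mul_assoc, mul_comm W, mul_assoc]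
    refine mul_le_mul_of_nonneg_left ?_ (sq_nonneg _)
    have htri : ‖(hol C A x₁ Γ (covDeriv C A (T1 C Ω Ω₂ A msq a (j + 1) (cb P N 0 (x', i'))) ⟨x₂, μ⟩)
          - covDeriv C A (T1 C Ω Ω₂ A msq a (j + 1) (cb P N 0 (x', i'))) ⟨x₁, μ⟩) +
        (hol C A x₁ Γ (covDeriv C A (T2 C Ω Ω₂ A msq a (j + 1) (cb P N 0 (x', i'))) ⟨x₂, μ⟩)
          - covDeriv C A (T2 C Ω Ω₂ A msq a (j + 1) (cb P N 0 (x', i'))) ⟨x₁, μ⟩) +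
        (hol C A x₁ Γ (covDeriv C A (T3 C Ω Ω₂ A msq a (j + 1) (cb P N 0 (x', i'))) ⟨x₂, μ⟩)
          - covDeriv C A (T3 C Ω Ω₂ A msq a (j + 1) (cb P N 0 (x', i'))) ⟨x₁, μ⟩)‖
        ≤ ‖hol C A x₁ Γ (covDeriv C A (T1 C Ω Ω₂ A msq a (j + 1) (cb P N 0 (x', i'))) ⟨x₂, μ⟩)
            - covDeriv C A (T1 C Ω Ω₂ A msq a (j + 1) (cb P N 0 (x', i'))) ⟨x₁, μ⟩‖ +
          ‖hol C A x₁ Γ (covDeriv C A (T2 C Ω Ω₂ A msq a (j + 1) (cb P N 0 (x', i'))) ⟨x₂, μ⟩)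
            - covDeriv C A (T2 C Ω Ω₂ A msq a (j + 1) (cb P N 0 (x', i'))) ⟨x₁, μ⟩‖ +
          ‖hol C A x₁ Γ (covDeriv C A (T3 C Ω Ω₂ A msq a (j + 1) (cb P N 0 (x', i'))) ⟨x₂, μ⟩)
            - covDeriv C A (T3 C Ω Ω₂ A msq a (j + 1) (cb P N 0 (x', i'))) ⟨x₁, μ⟩‖ :=
      (norm_add_le _ _).trans (add_le_add (norm_add_le _ _) le_rfl)
    refine (mul_le_mul_of_nonneg_left htri hW0).trans ?_
    rw [mul_add, mul_add]
    refine (add_le_add (add_le_add (hT1 i') (hT2 i')) (hT3 i')).trans (le_of_eq ?_)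
    unfold kT; ring
  have hsum : W * ∑ i' : Ix N, ‖hol C A x₁ Γ (covDeriv C A (dPiece C Ω Ω₂ A msq a k (j + 1) (cb P N 0 (x', i'))) ⟨x₂, μ⟩)
        - covDeriv C A (dPiece C Ω Ω₂ A msq a k (j + 1) (cb P N 0 (x', i'))) ⟨x₁, μ⟩‖
      ≤ N * (coeff221 P a (j + 1) ^ 2 * ((2 * kT N c₀ c₁ c₂ δ (profile P N (δ / 2)) (profile P N (δ / 2 / 2))) *
          (P.mesh (j + 1) ^ 5 * (((P.L : ℝ) ^ (j + 1)) ^ P.d)⁻¹) * Hw)) := by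
    rw [Finset.mul_sum]
    refine (Finset.sum_le_sum fun i' _ => hpiece i').trans ?_
    rw [Finset.sum_const, card_Ix, nsmul_eq_mul]
  have hkT : 0 ≤ kT N c₀ c₁ c₂ δ (profile P N (δ / 2)) (profile P N (δ / 2 / 2)) := kT_nonneg N hc₀ hc₁ hc₂
  have hm0 : 0 ≤ (P.mesh 0 ^ P.d)⁻¹ := inv_nonneg.mpr (pow_nonneg (P.mesh_pos 0).le _)
  -- the scaling identity
  have hid : (P.mesh 0 ^ P.d)⁻¹ * (N * (B1.aSeq a (P.L : ℝ) (j + 1) ^ 2 * (P.mesh (j + 1) ^ 4)⁻¹ *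
        ((2 * kT N c₀ c₁ c₂ δ (profile P N (δ / 2)) (profile P N (δ / 2 / 2))) *
          (P.mesh (j + 1) ^ 5 * (((P.L : ℝ) ^ (j + 1)) ^ P.d)⁻¹) * Hw)))
      = B1.aSeq a (P.L : ℝ) (j + 1) ^ 2 * ((N * (2 * kT N c₀ c₁ c₂ δ (profile P N (δ / 2)) (profile P N (δ / 2 / 2)))) *
          (P.mesh (j + 1) * (P.mesh (j + 1) ^ P.d)⁻¹) * Hw) := by
    have h5 : (P.mesh (j + 1) ^ 4)⁻¹ * P.mesh (j + 1) ^ 5 = P.mesh (j + 1) := by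
      rw [show (5 : ℕ) = 4 + 1 by norm_num, pow_add, pow_one, inv_mul_cancel_left₀ (pow_ne_zero _ hm.ne')]
    calc (P.mesh 0 ^ P.d)⁻¹ * (N * (B1.aSeq a (P.L : ℝ) (j + 1) ^ 2 * (P.mesh (j + 1) ^ 4)⁻¹ *
          ((2 * kT N c₀ c₁ c₂ δ (profile P N (δ / 2)) (profile P N (δ / 2 / 2))) *
            (P.mesh (j + 1) ^ 5 * (((P.L : ℝ) ^ (j + 1)) ^ P.d)⁻¹) * Hw)))
        = B1.aSeq a (P.L : ℝ) (j + 1) ^ 2 * ((N * (2 * kT N c₀ c₁ c₂ δ (profile P N (δ / 2)) (profile P N (δ / 2 / 2)))) * Hw) *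
            ((P.mesh 0 ^ P.d)⁻¹ * (((P.L : ℝ) ^ (j + 1)) ^ P.d)⁻¹) * ((P.mesh (j + 1) ^ 4)⁻¹ * P.mesh (j + 1) ^ 5) := by ring
      _ = _ := by rw [inv_mesh_zero_pow_mul, h5]; ring
  unfold dHolderTerm
  rw [← mul_assoc, mul_comm W, mul_assoc]
  refine (mul_le_mul_of_nonneg_left hsum hm0).trans ?_
  rw [B1Eq243HiggsModel.coeff221_sq, hid]
  have hrest : 0 ≤ (N * (2 * kT N c₀ c₁ c₂ δ (profile P N (δ / 2)) (profile P N (δ / 2 / 2)))) *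
      (P.mesh (j + 1) * (P.mesh (j + 1) ^ P.d)⁻¹) * Hw := by positivity
  calc B1.aSeq a (P.L : ℝ) (j + 1) ^ 2 * ((N * (2 * kT N c₀ c₁ c₂ δ (profile P N (δ / 2)) (profile P N (δ / 2 / 2)))) *
        (P.mesh (j + 1) * (P.mesh (j + 1) ^ P.d)⁻¹) * Hw)
      ≤ a ^ 2 * ((N * (2 * kT N c₀ c₁ c₂ δ (profile P N (δ / 2)) (profile P N (δ / 2 / 2)))) *
        (P.mesh (j + 1) * (P.mesh (j + 1) ^ P.d)⁻¹) * Hw) := mul_le_mul_of_nonneg_right (aSeq_sq_le ha hL1 (by omega)) hrest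
    _ = _ := by ring

/-- **THE δ-PIECE `j = 0`, HÖLDER-TRANSPORTED**: `δpiece_0 = δG_1`, bounded by the Hölder member of (I.2.26) at level `1` directly
(source `e_{(x′,i′)}`: sup `≤ √N`, support `{x′}`; margin `min(dist(x₁,Ω₂ᶜ), dist(x₂,Ω₂ᶜ))`). [cite: Balaban1983Higgs3, (2.6) p.424, (2.11) p.426]
[cite: Balaban1982Higgs1, Prop. 2.1 (2.26) with (2.24) p.610] -/
theorem absH_dPiece_zero_le {k : ℕ} {good : HiggsLattice.Site P 0 → Prop} {c₂ δ : ℝ} (hc₂ : 0 ≤ c₂) (hδ : 0 < δ)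
    (h26H : ∀ (g : ScalarField P 0 N) (M D D₀ : ℝ), (∀ x, ‖g x‖ ≤ M) → 0 ≤ D → 0 ≤ D₀ →
      ∀ (μ : Fin P.d) (x x' : HiggsLattice.Site P 0), x' ≠ x → good x → good x' →
        ∀ Γ : List (HiggsLattice.Site P 0), IsTChain x Γ → pathEnd x Γ = x' → (Γ.length : ℝ) ≤ (P.d : ℝ) * HiggsLattice.Site.tdist x x' →
        (∀ z, g z ≠ 0 → D ≤ (HiggsLattice.Site.tdist x z : ℝ)) → (∀ z, g z ≠ 0 → D ≤ (HiggsLattice.Site.tdist x' z : ℝ)) →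
        (∀ z, z ∉ Ω₂ → D₀ ≤ (HiggsLattice.Site.tdist x z : ℝ)) → (∀ z, z ∉ Ω₂ → D₀ ≤ (HiggsLattice.Site.tdist x' z : ℝ)) →
          (((HiggsLattice.Site.tdist x x' : ℝ) / (P.L : ℝ) ^ 1)⁻¹) ^ α *
              ‖hol C A x Γ (covDeriv C A (dG C Ω Ω₂ A msq a 1 g) ⟨x', μ⟩) - covDeriv C A (dG C Ω Ω₂ A msq a 1 g) ⟨x, μ⟩‖
            ≤ c₂ * P.mesh 1 * Real.exp (-(δ * ((D + D₀) / (P.L : ℝ) ^ 1))) * M)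
    (μ : Fin P.d) {x₁ x₂ : HiggsLattice.Site P 0} (hne : x₂ ≠ x₁) (hx₁ : good x₁) (hx₂ : good x₂) (x' : HiggsLattice.Site P 0)
    {Γ : List (HiggsLattice.Site P 0)} (hΓ : IsAdm x₁ x₂ Γ) :
    (((HiggsLattice.Site.tdist x₁ x₂ : ℝ) / (P.L : ℝ) ^ 1)⁻¹) ^ α * dHolderTerm C Ω Ω₂ A msq a k 0 μ x₁ x₂ x' Γ
      ≤ ((N : ℝ) * Real.sqrt N * c₂ * (P.L : ℝ)) * (P.mesh 0 * (P.mesh 0 ^ P.d)⁻¹) * hwgt Ω₂ δ ((P.L : ℝ) ^ 1) x₁ x₂ x' := by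
  have hT : (0 : ℝ) < (P.L : ℝ) ^ 1 := pow_pos (by exact_mod_cast P.hL) _
  set W : ℝ := (((HiggsLattice.Site.tdist x₁ x₂ : ℝ) / (P.L : ℝ) ^ 1)⁻¹) ^ α with hWdef
  have hW0 : 0 ≤ W := Real.rpow_nonneg (inv_nonneg.mpr (by positivity)) _
  set am : ℝ := min (distC Ω₂ x₁) (distC Ω₂ x₂) with ham
  have ham0 : 0 ≤ am := le_min (distC_nonneg _ _) (distC_nonneg _ _)
  set dm : ℝ := min (HiggsLattice.Site.tdist x₁ x' : ℝ) (HiggsLattice.Site.tdist x₂ x' : ℝ) with hdm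
  have hdm0 : 0 ≤ dm := le_min (Nat.cast_nonneg _) (Nat.cast_nonneg _)
  have hw : Real.exp (-(δ * ((dm + am) / (P.L : ℝ) ^ 1))) ≤ hwgt Ω₂ δ ((P.L : ℝ) ^ 1) x₁ x₂ x' := by
    have h1 := exp_pair_le_hwgt (Ω₂ := Ω₂) (x₁ := x₁) (x₂ := x₂) (x' := x') (γ := δ) (γ₁ := δ) (γ₂ := δ) hT hδ.le le_rfl le_rfl
      ham0 (min_le_left _ _)
    refine le_trans (le_of_eq ?_) h1
    rw [← Real.exp_add]; congr 1; rw [hdm]; ring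
  have hm1 : 0 < P.mesh 1 := P.mesh_pos 1
  have h1 : ∀ i' : Ix N, W * ‖hol C A x₁ Γ (covDeriv C A (dPiece C Ω Ω₂ A msq a k 0 (cb P N 0 (x', i'))) ⟨x₂, μ⟩)
        - covDeriv C A (dPiece C Ω Ω₂ A msq a k 0 (cb P N 0 (x', i'))) ⟨x₁, μ⟩‖
      ≤ c₂ * P.mesh 1 * hwgt Ω₂ δ ((P.L : ℝ) ^ 1) x₁ x₂ x' * Real.sqrt N := by
    intro i'
    rw [dPiece_zero]
    refine (h26H (cb P N 0 (x', i')) (Real.sqrt N) dm am (norm_cb_le _) hdm0 ham0 μ x₁ x₂ hne hx₁ hx₂ Γ hΓ.1 hΓ.2.1 hΓ.2.2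
      (fun z hz => by rw [eq_of_cb_ne_zero _ hz]; exact min_le_left _ _)
      (fun z hz => by rw [eq_of_cb_ne_zero _ hz]; exact min_le_right _ _)
      (fun z hz => (min_le_left _ _).trans (distC_le Ω₂ x₁ hz))
      (fun z hz => (min_le_right _ _).trans (distC_le Ω₂ x₂ hz))).trans ?_
    exact mul_le_mul_of_nonneg_right (mul_le_mul_of_nonneg_left hw (by positivity)) (Real.sqrt_nonneg _)
  have hsum : W * ∑ i' : Ix N, ‖hol C A x₁ Γ (covDeriv C A (dPiece C Ω Ω₂ A msq a k 0 (cb P N 0 (x', i'))) ⟨x₂, μ⟩)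
        - covDeriv C A (dPiece C Ω Ω₂ A msq a k 0 (cb P N 0 (x', i'))) ⟨x₁, μ⟩‖
      ≤ N * (c₂ * P.mesh 1 * hwgt Ω₂ δ ((P.L : ℝ) ^ 1) x₁ x₂ x' * Real.sqrt N) := by
    rw [Finset.mul_sum]
    refine (Finset.sum_le_sum fun i' _ => h1 i').trans ?_
    rw [Finset.sum_const, card_Ix, nsmul_eq_mul]
  have hm0 : 0 ≤ (P.mesh 0 ^ P.d)⁻¹ := inv_nonneg.mpr (pow_nonneg (P.mesh_pos 0).le _)
  unfold dHolderTerm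
  rw [← mul_assoc, mul_comm W, mul_assoc]
  refine (mul_le_mul_of_nonneg_left hsum hm0).trans (le_of_eq ?_)
  rw [mesh_eq_pow_mul P 1, pow_one]
  ring

/-- **No δ-pieces beyond `j = k − 1`** (Hölder term). [cite: Balaban1983Higgs3, (2.6) p.424] -/
theorem dHolderTerm_eq_zero_of_le {k j : ℕ} (hj1 : 1 ≤ j) (hkj : k ≤ j) (μ : Fin P.d) (x₁ x₂ x' : HiggsLattice.Site P 0)
    (Γ : List (HiggsLattice.Site P 0)) : dHolderTerm C Ω Ω₂ A msq a k j μ x₁ x₂ x' Γ = 0 := by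
  simp [dHolderTerm, dPiece_of_le hj1 hkj, covDeriv_zero'']

end PieceBounds

/-! ## §4 The Hölder entry of the δ-pieces at a regular background for nested big-block regions: the inputs fed in -/

section Main

open B1Ineq234Concrete (nCol)

variable {d L : ℕ} {a c₀ c₁ c₂ δ : ℝ}

/-- kernel: `(L^jη)^{1−d−α} = (L^jη)·((L^jη)^d)^{−1}·((L^jη)^α)^{−1}`. [folklore] -/
private theorem rpow_one_sub_sub (j : ℕ) (α : ℝ) :
    P.mesh j ^ ((1 : ℝ) - (P.d : ℝ) - α) = P.mesh j * (P.mesh j ^ P.d)⁻¹ * (P.mesh j ^ α)⁻¹ := by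
  have hs := P.mesh_pos j
  rw [Real.rpow_sub hs, Real.rpow_sub hs, Real.rpow_one, Real.rpow_natCast _ P.d, div_eq_mul_inv, div_eq_mul_inv]

/-- the inverse Hölder weight in the print's units: `(|x₁−x₂|/L^j)^α = (ε|x₁−x₂|)^α·((L^jε)^α)^{−1}`. [cite: Balaban1983Higgs3, (2.11) p.426] -/
private theorem weight_inv_eq (j : ℕ) {t α : ℝ} (ht : 0 ≤ t) :
    (t / (P.L : ℝ) ^ j) ^ α = (P.mesh 0 * t) ^ α * (P.mesh j ^ α)⁻¹ := by
  have hm0 : 0 < P.mesh 0 := P.mesh_pos 0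
  have hmj : 0 < P.mesh j := P.mesh_pos j
  have e : t / (P.L : ℝ) ^ j = (P.mesh 0 * t) / P.mesh j := by
    rw [mesh_eq_pow_mul P j]
    have hLj : (P.L : ℝ) ^ j ≠ 0 := (pow_pos (by exact_mod_cast P.hL) j).ne'
    field_simp
  rw [e, Real.div_rpow (by positivity) hmj.le, div_eq_mul_inv]

/-- removing the Hölder weight: `(t/T)^{−α}·X ≤ B` with `t > 0` gives `X ≤ (t/T)^α·B`. [folklore] -/
private theorem le_of_weight_mul_le {w X B α : ℝ} (hw : 0 < w) (h : (w⁻¹) ^ α * X ≤ B) : X ≤ w ^ α * B := by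
  have hwα : 0 < w ^ α := Real.rpow_pos_of_pos hw α
  rw [Real.inv_rpow hw.le, inv_mul_le_iff₀ hwα] at h
  exact h

/-- p35's (I.2.26) rate `(·)/(8K₀L^l)` dominates a common rate `δ ≤ 1/(8K₀)`. [folklore] -/
private theorem exp_p35_le8 {K₀ l : ℕ} (hK₀ : 0 < K₀) {δ D : ℝ} (hδ : δ ≤ 1 / (8 * K₀)) (hD : 0 ≤ D) (hLl : (0 : ℝ) < (P.L : ℝ) ^ l) :
    Real.exp (-(D / (8 * K₀ * (P.L : ℝ) ^ l))) ≤ Real.exp (-(δ * (D / (P.L : ℝ) ^ l))) := by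
  apply Real.exp_le_exp.mpr
  apply neg_le_neg
  have hK : (0 : ℝ) < 8 * K₀ := by positivity
  have h1 : D / (8 * K₀ * (P.L : ℝ) ^ l) = 1 / (8 * K₀) * (D / (P.L : ℝ) ^ l) := by
    field_simp
  rw [h1]
  exact mul_le_mul_of_nonneg_right hδ (by positivity)

/-- p35's (I.2.24)/(I.2.25) rate `(·)/(4K₀L^l)` dominates a common rate `δ ≤ 1/(8K₀)`. [folklore] -/
private theorem exp_p35_le4 {K₀ l : ℕ} (hK₀ : 0 < K₀) {δ D : ℝ} (hδ : δ ≤ 1 / (8 * K₀)) (hD : 0 ≤ D) (hLl : (0 : ℝ) < (P.L : ℝ) ^ l) :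
    Real.exp (-(D / (4 * K₀ * (P.L : ℝ) ^ l))) ≤ Real.exp (-(δ * (D / (P.L : ℝ) ^ l))) := by
  apply Real.exp_le_exp.mpr
  apply neg_le_neg
  have hK : (0 : ℝ) < 4 * K₀ := by positivity
  have h1 : D / (4 * K₀ * (P.L : ℝ) ^ l) = 1 / (4 * K₀) * (D / (P.L : ℝ) ^ l) := by
    field_simp
  rw [h1]
  have h2 : δ ≤ 1 / (4 * K₀) := hδ.trans (by
    rw [div_le_div_iff₀ (by positivity) (by positivity)]; nlinarith)
  exact mul_le_mul_of_nonneg_right h2 (by positivity)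

/-- the joint weight at scale `T` against the carrier's exponentials at rate `r` with `rT ≤ γ`. [folklore] -/
private theorem hwgt_le_exp {Ω₂ : Finset (HiggsLattice.Site P 0)} {γ T r : ℝ} (hT : 0 < T) (hrT : r * T ≤ γ)
    (x₁ x₂ x' : HiggsLattice.Site P 0) :
    hwgt Ω₂ γ T x₁ x₂ x'
      ≤ Real.exp (-(r * min (HiggsLattice.Site.tdist x₁ x' : ℝ) (HiggsLattice.Site.tdist x₂ x' : ℝ))) *
        Real.exp (-(r * min (min (distC Ω₂ x₁) (distC Ω₂ x₂)) (distC Ω₂ x'))) := by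
  unfold hwgt
  rw [mul_comm]
  have hS1 : 0 ≤ min (HiggsLattice.Site.tdist x₁ x' : ℝ) (HiggsLattice.Site.tdist x₂ x' : ℝ) :=
    le_min (Nat.cast_nonneg _) (Nat.cast_nonneg _)
  have hS2 : 0 ≤ min (min (distC Ω₂ x₁) (distC Ω₂ x₂)) (distC Ω₂ x') :=
    le_min (le_min (distC_nonneg _ _) (distC_nonneg _ _)) (distC_nonneg _ _)
  have key : ∀ S : ℝ, 0 ≤ S → Real.exp (-(γ * (S / T))) ≤ Real.exp (-(r * S)) := by
    intro S hS
    apply Real.exp_le_exp.mpr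
    apply neg_le_neg
    rw [mul_div_assoc', le_div_iff₀ hT]
    calc r * S * T = (r * T) * S := by ring
      _ ≤ γ * S := mul_le_mul_of_nonneg_right hrT hS
  exact mul_le_mul (key _ hS1) (key _ hS2) (Real.exp_pos _).le (Real.exp_pos _).le

set_option maxHeartbeats 1600000 in
/-- **THE HÖLDER ENTRY OF THE δ-PIECES OF `δG_k(Ω,Ω₂,A)` AT A REGULAR NON-CONSTANT BACKGROUND FOR NESTED BIG-BLOCK REGIONS: (2.11)'s FORM
WITH THE BOUNDARY FACTOR OF (2.5)/(I.2.26)** («This applies also to Hölder norms», (2.11) p. 426; (2.5) p. 424).  For `d ≥ 1`, `L ≥ 2`,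
`a, m² > 0`, `c ≥ 0`, `N` there is `E₀ > 0` such that for every charge with `e² ≤ E₀` there is a threshold `K₀,min` (chosen BEFORE `α`) and,
for every `0 ≤ α < 1` and every `K₀ ≥ K₀,min`, constants `t, δ₁, C > 0` with: for every volume `P` with these `d, L` and `K₀ ∣ M`, every scale
`1 ≤ k ≤ K` with `L^kε ≤ 1` and `3L^kK₀ ≤ |T_ε|_μ`, every NESTED pair of big-block unions `Ω₂ ⊆ Ω ⊂ T_ε` (`IsBigBlockUnion k K₀`), every `A`
`δ_A`-regular on `Ω` with `L^kδ_A|e| ≤ t`, `L^kδ_A ≤ c|e|`, every `j`, every direction `μ`, all INTERIOR points `x₁ ≠ x₂`, `x′` of `Ω₂`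
(`Interior k K₀ Ω₂`) and every admissible contour `Γ` from `x₁` to `x₂` (`IsAdm`):
`ε^{−d}Σ_{i′}‖U(A(Γ))(D^ε_{A,μ}δpiece_j e_{(x′,i′)})(x₂) − (D^ε_{A,μ}δpiece_j e_{(x′,i′)})(x₁)‖
 ≤ (ε|x₁−x₂|)^α · C(L^jε)^{1−d−α} · e^{−δ₁(L^jε)^{−1}ε·min(|x₁−x′|,|x₂−x′|)} · e^{−δ₁(L^jε)^{−1}ε·min(dist(x₁,Ω₂ᶜ),dist(x₂,Ω₂ᶜ),dist(x′,Ω₂ᶜ))}`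
(lattice-step distances `tdist`, `distC`).  Route: §1–§3 with the Hölder members of (I.2.24) (p35 `B1Ineq224RegularRegion`) and (I.2.26) (p35
`B1Ineq226HolderRegularRegion`) on the left factors, the value inputs (I.2.25)/(I.2.26)/(I.2.34)/(I.2.36)/(I.2.38) as in r14's
`dPiece_bound_explicit`.  Honest scope in the module docstring.
[cite: Balaban1983Higgs3, (1.16) p.414, (1.32) p.420, (2.5)–(2.6) p.424, (2.11) p.426]
[cite: Balaban1982Higgs1, Prop. 2.1 (2.24)–(2.26) p.610, Prop. 2.3 (2.34) p.611, (2.36)–(2.38) p.612, (2.43) p.612] -/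
theorem dPiece_holder_bound_explicit (d L : ℕ) (hd : 1 ≤ d) (hL : 2 ≤ L) {a : ℝ} (ha : 0 < a) {msq : ℝ} (hmsq : 0 < msq)
    {c : ℝ} (hc : 0 ≤ c) (N : ℕ) :
    ∃ E₀ : ℝ, 0 < E₀ ∧ ∀ (C : ChargeData N), C.e ^ 2 ≤ E₀ →
      ∃ K₀min : ℕ, ∀ {α : ℝ}, 0 ≤ α → α < 1 → ∀ K₀ : ℕ, K₀min ≤ K₀ → ∃ t δ₁ Cst : ℝ, 0 < t ∧ 0 < δ₁ ∧ 0 < Cst ∧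
      ∀ (P : HiggsLattice.Params), 1 < P.L → P.d = d → P.L = L → K₀ ∣ P.M →
      ∀ {k : ℕ}, 1 ≤ k → k ≤ P.K → (∀ μ, 3 * half P k K₀ ≤ P.sitesPerDir 0 μ) → P.mesh k ≤ 1 →
      ∀ (Ω Ω₂ : Finset (HiggsLattice.Site P 0)), IsBigBlockUnion k K₀ Ω → IsBigBlockUnion k K₀ Ω₂ → Ω₂ ⊆ Ω →
      ∀ (A : HiggsLattice.VecField P 0) {δA : ℝ}, 0 ≤ δA →
        (∀ z ∈ Ω, ∀ μ ν : Fin P.d, |A ⟨z.shift ν, μ⟩ - A ⟨z, μ⟩| ≤ δA) →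
        (P.L : ℝ) ^ k * δA * |C.e| ≤ t → (P.L : ℝ) ^ k * δA ≤ c * |C.e| →
        ∀ (j : ℕ) (μ : Fin P.d) (x₁ x₂ x' : HiggsLattice.Site P 0), Interior k K₀ Ω₂ x₁ → Interior k K₀ Ω₂ x₂ →
          Interior k K₀ Ω₂ x' → x₁ ≠ x₂ → ∀ (Γ : List (HiggsLattice.Site P 0)), IsAdm x₁ x₂ Γ →
          dHolderTerm C Ω Ω₂ A msq a k j μ x₁ x₂ x' Γ
              ≤ (P.mesh 0 * (HiggsLattice.Site.tdist x₁ x₂ : ℝ)) ^ α * (Cst * P.mesh j ^ ((1 : ℝ) - (P.d : ℝ) - α)) *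
                Real.exp (-(δ₁ * (P.mesh j)⁻¹ *
                  (P.mesh 0 * min (HiggsLattice.Site.tdist x₁ x' : ℝ) (HiggsLattice.Site.tdist x₂ x' : ℝ)))) *
                Real.exp (-(δ₁ * (P.mesh j)⁻¹ * (P.mesh 0 * min (min (distC Ω₂ x₁) (distC Ω₂ x₂)) (distC Ω₂ x')))) := by
  have hL1 : 1 < L := by omega
  obtain ⟨E₀a, c₁a, ρa, hE₀a, hc₁a, hρa, hCov⟩ := B1Prop23RegularRegion.prop23_regular_region d L hL1 ha hmsq hc N
  obtain ⟨E₀b, c₁b, ρb, hE₀b, hc₁b, hρb, hCov38⟩ := B1Ineq238RegularRegion.prop23_238_regular_region d L hL1 ha hmsq hc N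
  refine ⟨min E₀a E₀b, lt_min hE₀a hE₀b, fun C heE => ?_⟩
  have heA : C.e ^ 2 ≤ E₀a := heE.trans (min_le_left _ _)
  have heB : C.e ^ 2 ≤ E₀b := heE.trans (min_le_right _ _)
  obtain ⟨K₁, hV⟩ :=
    B1Ineq225RegularRegion.norm_propagatorK_region_reg_decay_sum d L hd hL ha hmsq N C 1 1 1 zero_le_one one_pos
  obtain ⟨K₃, h26S⟩ :=
    B1Ineq226RegularRegionSum.deltaG_region_reg_decay_sum d L hd hL ha hmsq N C 1 1 1 zero_le_one one_pos
  obtain ⟨K₄, hHol⟩ :=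
    B1Ineq224RegularRegion.norm_holder_propagatorK_region_reg_decay_sum d L hd hL ha hmsq N C 1 1 1 zero_le_one one_pos
  obtain ⟨K₅, hHolD⟩ :=
    B1Ineq226HolderRegularRegion.holder_deltaG_region_reg_decay_sum d L hd hL ha hmsq N C 1 1 1 zero_le_one one_pos
  refine ⟨max (max (max (max K₁ K₃) K₄) K₅) 1, fun {α} hα0 hα1 K₀ hK₀ => ?_⟩
  have hK₁ : K₁ ≤ K₀ := ((((le_max_left _ _).trans (le_max_left _ _)).trans (le_max_left _ _)).trans (le_max_left _ _)).trans hK₀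
  have hK₃ : K₃ ≤ K₀ := ((((le_max_right _ _).trans (le_max_left _ _)).trans (le_max_left _ _)).trans (le_max_left _ _)).trans hK₀
  have hK₄ : K₄ ≤ K₀ := (((le_max_right _ _).trans (le_max_left _ _)).trans (le_max_left _ _)).trans hK₀
  have hK₅ : K₅ ≤ K₀ := ((le_max_right _ _).trans (le_max_left _ _)).trans hK₀
  have hK₀1 : 1 ≤ K₀ := (le_max_right _ _).trans hK₀
  obtain ⟨c₀, e₁, hc₀, he₁, hV⟩ := hV K₀ hK₁
  obtain ⟨c₂, e₃, hc₂, he₃, h26S⟩ := h26S K₀ hK₃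
  obtain ⟨cH, eH, hcH, heH, hH⟩ := hHol hα0 hα1 K₀ hK₄
  obtain ⟨cHD, eHD, hcHD, heHD, hHD⟩ := hHolD hα0 hα1 K₀ hK₅
  -- common (I.2.25)/(I.2.24) constant and common (I.2.26) value/Hölder constant
  obtain ⟨c₀m, hc₀m⟩ : ∃ c₀m : ℝ, c₀m = max c₀ cH := ⟨_, rfl⟩
  have hc₀le : c₀ ≤ c₀m := by rw [hc₀m]; exact le_max_left _ _
  have hcHle : cH ≤ c₀m := by rw [hc₀m]; exact le_max_right _ _
  have hc₀m0 : 0 ≤ c₀m := hc₀.le.trans hc₀le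
  obtain ⟨c₂m, hc₂m⟩ : ∃ c₂m : ℝ, c₂m = max c₂ cHD := ⟨_, rfl⟩
  have hc₂le : c₂ ≤ c₂m := by rw [hc₂m]; exact le_max_left _ _
  have hcHDle : cHD ≤ c₂m := by rw [hc₂m]; exact le_max_right _ _
  have hc₂m0 : 0 ≤ c₂m := hc₂.le.trans hc₂le
  -- the common rate, the middle constant, the threshold and the constant
  obtain ⟨δ, hδ⟩ : ∃ δ : ℝ, δ = min (1 / (8 * (K₀ : ℝ))) (min ρa ρb) := ⟨_, rfl⟩
  have hδpos : 0 < δ := by rw [hδ]; exact lt_min (by positivity) (lt_min hρa hρb)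
  have hδ8 : δ ≤ 1 / (8 * K₀) := by rw [hδ]; exact min_le_left _ _
  have hδa : δ ≤ ρa := by rw [hδ]; exact (min_le_right _ _).trans (min_le_left _ _)
  have hδb : δ ≤ ρb := by rw [hδ]; exact (min_le_right _ _).trans (min_le_right _ _)
  obtain ⟨c₁, hc₁⟩ : ∃ c₁ : ℝ, c₁ = max c₁a c₁b := ⟨_, rfl⟩
  have hc₁a' : c₁a ≤ c₁ := by rw [hc₁]; exact le_max_left _ _
  have hc₁b' : c₁b ≤ c₁ := by rw [hc₁]; exact le_max_right _ _
  have hc₁0 : 0 ≤ c₁ := hc₁a.le.trans hc₁a'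
  have hLpos : (0 : ℝ) < L := by exact_mod_cast (by omega : 0 < L)
  refine ⟨min (min e₁ e₃) (min eH eHD), δ / (4 * L), 2 * cst25 d L N a c₀m c₁ c₂m δ, lt_min (lt_min he₁ he₃) (lt_min heH heHD),
    div_pos hδpos (by positivity), by have := cst25_pos (d := d) (L := L) (a := a) (δ := δ) N hc₀m0 hc₁0 hc₂m0; positivity, ?_⟩
  intro P hP1 hPd hPL hK₀M k hk1 hkK h3 hmesh Ω Ω₂ hΩ hΩ₂ hsub A δA hδA hreg ht hcA j μ x₁ x₂ x' hx₁ hx₂ hx' hx12 Γ hΓ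
  subst hPd hPL
  have hL1' : 1 < P.L := hP1
  have hLr : 1 < (P.L : ℝ) := by exact_mod_cast hL1'
  have hLge1 : (1 : ℝ) ≤ P.L := hLr.le
  have hCst : 0 < cst25 P.d P.L N a c₀m c₁ c₂m δ := cst25_pos N hc₀m0 hc₁0 hc₂m0
  have hm0 : 0 < P.mesh 0 := P.mesh_pos 0
  have hne : x₂ ≠ x₁ := fun h => hx12 h.symm
  have hte₁ : (P.L : ℝ) ^ k * δA * |C.e| ≤ e₁ := ht.trans ((min_le_left _ _).trans (min_le_left _ _))
  have hte₃ : (P.L : ℝ) ^ k * δA * |C.e| ≤ e₃ := ht.trans ((min_le_left _ _).trans (min_le_right _ _))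
  have hteH : (P.L : ℝ) ^ k * δA * |C.e| ≤ eH := ht.trans ((min_le_right _ _).trans (min_le_left _ _))
  have hteHD : (P.L : ℝ) ^ k * δA * |C.e| ≤ eHD := ht.trans ((min_le_right _ _).trans (min_le_right _ _))
  have hreg₂ : ∀ z ∈ Ω₂, ∀ μ ν : Fin P.d, |A ⟨z.shift ν, μ⟩ - A ⟨z, μ⟩| ≤ δA := fun z hz => hreg z (hsub hz)
  -- abbreviations for the target quantities
  set t12 : ℝ := (HiggsLattice.Site.tdist x₁ x₂ : ℝ) with ht12
  set dm : ℝ := min (HiggsLattice.Site.tdist x₁ x' : ℝ) (HiggsLattice.Site.tdist x₂ x' : ℝ) with hdm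
  set mm : ℝ := min (min (distC Ω₂ x₁) (distC Ω₂ x₂)) (distC Ω₂ x') with hmm
  have ht12pos : 0 < t12 := by
    rw [ht12]; exact_mod_cast Nat.one_le_iff_ne_zero.mp (one_le_tdist_of_ne' hne) |> Nat.pos_of_ne_zero
  have hdm0 : 0 ≤ dm := le_min (Nat.cast_nonneg _) (Nat.cast_nonneg _)
  have hmm0 : 0 ≤ mm := le_min (le_min (distC_nonneg _ _) (distC_nonneg _ _)) (distC_nonneg _ _)
  -- the right-hand side is non-negative; the case `Ω₂ = T_ε` (then `Ω = T_ε` and every δ-piece vanishes)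
  have hRHS : 0 ≤ (P.mesh 0 * t12) ^ α * (2 * cst25 P.d P.L N a c₀m c₁ c₂m δ * P.mesh j ^ ((1 : ℝ) - (P.d : ℝ) - α)) *
      Real.exp (-(δ / (4 * P.L) * (P.mesh j)⁻¹ * (P.mesh 0 * dm))) *
      Real.exp (-(δ / (4 * P.L) * (P.mesh j)⁻¹ * (P.mesh 0 * mm))) := by
    have := (P.mesh_pos j).le
    have h1 : 0 ≤ (P.mesh 0 * t12) ^ α := Real.rpow_nonneg (by positivity) _
    have h2 : 0 ≤ P.mesh j ^ ((1 : ℝ) - (P.d : ℝ) - α) := Real.rpow_nonneg this _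
    positivity
  by_cases huniv : Ω₂ = Finset.univ
  · have hΩu : Ω = Finset.univ := Finset.eq_univ_of_forall fun z => hsub (huniv ▸ Finset.mem_univ z)
    have h0 : dPiece C Ω Ω₂ A msq a k j = 0 := by rw [dPiece, hΩu, huniv, sub_self]
    have hT0 : dHolderTerm C Ω Ω₂ A msq a k j μ x₁ x₂ x' Γ = 0 := by
      simp [dHolderTerm, h0, covDeriv_zero'']
    rw [hT0]
    exact hRHS
  obtain ⟨z₀, hz₀⟩ : ∃ z₀, z₀ ∉ Ω₂ :=
    not_forall.mp fun h => huniv (Finset.eq_univ_of_forall h)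
  -- block-union facts at every level `l ≤ k`
  have hΩl : ∀ {l : ℕ}, l ≤ k → ∀ x x' : HiggsLattice.Site P 0, blockIter l x = blockIter l x' → (x ∈ Ω ↔ x' ∈ Ω) :=
    fun hl => blockUnion_of_isBigBlockUnion hl hΩ
  have hΩ₂l : ∀ {l : ℕ}, l ≤ k → ∀ x x' : HiggsLattice.Site P 0, blockIter l x = blockIter l x' → (x ∈ Ω₂ ↔ x' ∈ Ω₂) :=
    fun hl => blockUnion_of_isBigBlockUnion hl hΩ₂
  -- (I.2.25) for `Ω` in engine form at interior points of `Ω₂`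
  have hGl : ∀ {l : ℕ}, 1 ≤ l → l ≤ k → ∀ (g : ScalarField P 0 N) (M D : ℝ), (∀ x, ‖g x‖ ≤ M) → 0 ≤ D →
      ∀ x, Interior k K₀ Ω₂ x → (∀ z, g z ≠ 0 → D ≤ (HiggsLattice.Site.tdist x z : ℝ)) →
        ‖propagatorK C Ω A msq a l g x‖ ≤ c₀m * P.mesh l ^ 2 * Real.exp (-(δ * (D / (P.L : ℝ) ^ l))) * M := by
    intro l hl1 hlk g M D hg hD0 x hx hsupp
    have hmesh_l : P.mesh l ≤ 1 := (mesh_mono P hlk).trans hmesh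
    have h3l : ∀ μ, 3 * half P l K₀ ≤ P.sitesPerDir 0 μ := fun μ => (Nat.mul_le_mul_left _ (half_mono hlk)).trans (h3 μ)
    have hak : 0 ≤ B1.aSeq a P.L l := (B1.aSeq_pos ha hLr hl1).le
    have h := hV P rfl rfl hK₀M hl1 (hlk.trans hkK) h3l hmesh_l Ω (isBigBlockUnion_of_le hlk hΩ) A he₁ le_rfl
      (reg223R_of_small C Ω A hlk hmesh_l he₁ hδA hreg hte₁ le_rfl) x (fun y hy => hsub (hx.margin hlk y hy)) g M D hg hD0 hsupp
    rw [← propagatorK_apply_eq_chi C A hmsq hak (hΩl hlk) g (hsub hx.mem)] at h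
    refine h.trans ?_
    have hM : 0 ≤ M := (norm_nonneg _).trans (hg x)
    have hLl : (0 : ℝ) < (P.L : ℝ) ^ l := pow_pos (by exact_mod_cast P.hL) l
    have hexp := exp_p35_le4 (P := P) (by omega : 0 < K₀) hδ8 hD0 hLl
    have hml : 0 ≤ P.mesh l ^ 2 := sq_nonneg _
    exact mul_le_mul_of_nonneg_right (mul_le_mul (mul_le_mul_of_nonneg_right hc₀le hml) hexp (Real.exp_pos _).le
      (by positivity)) hM
  -- (I.2.24) for `Ω₂` in engine form at interior row points of `Ω₂`
  have hH₂l : ∀ {l : ℕ}, 1 ≤ l → l ≤ k → ∀ (g : ScalarField P 0 N) (M D : ℝ), (∀ x, ‖g x‖ ≤ M) → 0 ≤ D →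
      ∀ (μ : Fin P.d) (x x' : HiggsLattice.Site P 0), x' ≠ x → Interior k K₀ Ω₂ x → Interior k K₀ Ω₂ x' →
        ∀ Γ : List (HiggsLattice.Site P 0), IsTChain x Γ →
        pathEnd x Γ = x' → (Γ.length : ℝ) ≤ (P.d : ℝ) * HiggsLattice.Site.tdist x x' →
        (∀ z, g z ≠ 0 → D ≤ (HiggsLattice.Site.tdist x z : ℝ)) → (∀ z, g z ≠ 0 → D ≤ (HiggsLattice.Site.tdist x' z : ℝ)) →
          (((HiggsLattice.Site.tdist x x' : ℝ) / (P.L : ℝ) ^ l)⁻¹) ^ α *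
              ‖hol C A x Γ (covDeriv C A (propagatorK C Ω₂ A msq a l g) ⟨x', μ⟩)
                - covDeriv C A (propagatorK C Ω₂ A msq a l g) ⟨x, μ⟩‖
            ≤ c₀m * P.mesh l * Real.exp (-(δ * (D / (P.L : ℝ) ^ l))) * M := by
    intro l hl1 hlk g M D hg hD0 μ x x' hne hx hx' Γ hch hend hlen hDx hDx'
    have hmesh_l : P.mesh l ≤ 1 := (mesh_mono P hlk).trans hmesh
    have h3l : ∀ μ, 3 * half P l K₀ ≤ P.sitesPerDir 0 μ := fun μ => (Nat.mul_le_mul_left _ (half_mono hlk)).trans (h3 μ)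
    have hak : 0 ≤ B1.aSeq a P.L l := (B1.aSeq_pos ha hLr hl1).le
    have h := hH P rfl rfl hK₀M hl1 (hlk.trans hkK) h3l hmesh_l Ω₂ (isBigBlockUnion_of_le hlk hΩ₂) A heH le_rfl
      (reg223R_of_small C Ω₂ A hlk hmesh_l heH hδA hreg₂ hteH le_rfl) μ x x' hne (hx.margin' hlk) (hx'.margin' hlk) Γ hch hend hlen
      g M D hg hD0 hDx hDx'
    have hcut : ∀ y ∈ Ω₂, propagatorK C Ω₂ A msq a l (chi Ω₂ • g) y = propagatorK C Ω₂ A msq a l g y :=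
      fun y hy => (propagatorK_apply_eq_chi C A hmsq hak (hΩ₂l hlk) g hy).symm
    have hD' : ∀ {y : HiggsLattice.Site P 0}, Interior k K₀ Ω₂ y →
        covDeriv C A (propagatorK C Ω₂ A msq a l (chi Ω₂ • g)) ⟨y, μ⟩ = covDeriv C A (propagatorK C Ω₂ A msq a l g) ⟨y, μ⟩ :=
      fun {y} hy => covDeriv_congr_bond C A (hcut _ hy.mem) (hcut _ (hy.shift_mem μ))
    rw [hD' hx, hD' hx'] at h
    refine h.trans ?_
    have hM : 0 ≤ M := (norm_nonneg _).trans (hg x)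
    have hml : 0 < P.mesh l := P.mesh_pos l
    have hLl : (0 : ℝ) < (P.L : ℝ) ^ l := pow_pos (by exact_mod_cast P.hL) l
    have hexp := exp_p35_le4 (P := P) (by omega : 0 < K₀) hδ8 hD0 hLl
    exact mul_le_mul_of_nonneg_right (mul_le_mul (mul_le_mul_of_nonneg_right hcHle hml.le) hexp (Real.exp_pos _).le
      (by positivity)) hM
  -- (I.2.26) value in engine form at interior points of `Ω₂`
  have h26l : ∀ {l : ℕ}, 1 ≤ l → l ≤ k → ∀ (g : ScalarField P 0 N) (M D D₀ : ℝ), (∀ x, ‖g x‖ ≤ M) → 0 ≤ D → 0 ≤ D₀ →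
      ∀ x, Interior k K₀ Ω₂ x → (∀ z, g z ≠ 0 → D ≤ (HiggsLattice.Site.tdist x z : ℝ)) →
      (∀ z, z ∉ Ω₂ → D₀ ≤ (HiggsLattice.Site.tdist x z : ℝ)) →
        ‖dG C Ω Ω₂ A msq a l g x‖ ≤ c₂m * P.mesh l ^ 2 * Real.exp (-(δ * ((D + D₀) / (P.L : ℝ) ^ l))) * M := by
    intro l hl1 hlk g M D D₀ hg hD0 hD₀0 x hx hsupp hD₀
    have hmesh_l : P.mesh l ≤ 1 := (mesh_mono P hlk).trans hmesh
    have h3l : ∀ μ, 3 * half P l K₀ ≤ P.sitesPerDir 0 μ := fun μ => (Nat.mul_le_mul_left _ (half_mono hlk)).trans (h3 μ)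
    have hak : 0 ≤ B1.aSeq a P.L l := (B1.aSeq_pos ha hLr hl1).le
    have h := (h26S P rfl rfl hK₀M hl1 (hlk.trans hkK) h3l hmesh_l Ω₂ Ω (isBigBlockUnion_of_le hlk hΩ₂)
      (isBigBlockUnion_of_le hlk hΩ) hsub A he₃ le_rfl (reg223R_of_small C Ω A hlk hmesh_l he₃ hδA hreg hte₃ le_rfl) x
      (hx.margin' hlk) g M D D₀ 0 hg hD0 hD₀0 le_rfl hsupp hD₀ (fun y z _ _ => Nat.cast_nonneg _)).1
    rw [dG_apply_eq_chi C Ω Ω₂ A msq a hsub hmsq hak (hΩl hlk) (hΩ₂l hlk) g hx.mem, norm_sub_rev]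
    refine h.trans ?_
    have hM : 0 ≤ M := (norm_nonneg _).trans (hg x)
    have hLl : (0 : ℝ) < (P.L : ℝ) ^ l := pow_pos (by exact_mod_cast P.hL) l
    have hexp := exp_p35_le8 (P := P) (by omega : 0 < K₀) hδ8 (by positivity : 0 ≤ D + D₀) hLl
    rw [add_zero]
    have hml : 0 ≤ P.mesh l ^ 2 := sq_nonneg _
    exact mul_le_mul_of_nonneg_right (mul_le_mul (mul_le_mul_of_nonneg_right hc₂le hml) hexp (Real.exp_pos _).le
      (by positivity)) hM
  -- (I.2.26) HÖLDER in engine form at interior row points of `Ω₂`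
  have h26Hl : ∀ {l : ℕ}, 1 ≤ l → l ≤ k → ∀ (g : ScalarField P 0 N) (M D D₀ : ℝ), (∀ x, ‖g x‖ ≤ M) → 0 ≤ D → 0 ≤ D₀ →
      ∀ (μ : Fin P.d) (x x' : HiggsLattice.Site P 0), x' ≠ x → Interior k K₀ Ω₂ x → Interior k K₀ Ω₂ x' →
        ∀ Γ : List (HiggsLattice.Site P 0), IsTChain x Γ → pathEnd x Γ = x' → (Γ.length : ℝ) ≤ (P.d : ℝ) * HiggsLattice.Site.tdist x x' →
        (∀ z, g z ≠ 0 → D ≤ (HiggsLattice.Site.tdist x z : ℝ)) → (∀ z, g z ≠ 0 → D ≤ (HiggsLattice.Site.tdist x' z : ℝ)) →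
        (∀ z, z ∉ Ω₂ → D₀ ≤ (HiggsLattice.Site.tdist x z : ℝ)) → (∀ z, z ∉ Ω₂ → D₀ ≤ (HiggsLattice.Site.tdist x' z : ℝ)) →
          (((HiggsLattice.Site.tdist x x' : ℝ) / (P.L : ℝ) ^ l)⁻¹) ^ α *
              ‖hol C A x Γ (covDeriv C A (dG C Ω Ω₂ A msq a l g) ⟨x', μ⟩) - covDeriv C A (dG C Ω Ω₂ A msq a l g) ⟨x, μ⟩‖
            ≤ c₂m * P.mesh l * Real.exp (-(δ * ((D + D₀) / (P.L : ℝ) ^ l))) * M := by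
    intro l hl1 hlk g M D D₀ hg hD0 hD₀0 μ x x' hne hx hx' Γ hch hend hlen hDx hDx' hD₀x hD₀x'
    have hmesh_l : P.mesh l ≤ 1 := (mesh_mono P hlk).trans hmesh
    have h3l : ∀ μ, 3 * half P l K₀ ≤ P.sitesPerDir 0 μ := fun μ => (Nat.mul_le_mul_left _ (half_mono hlk)).trans (h3 μ)
    have hak : 0 ≤ B1.aSeq a P.L l := (B1.aSeq_pos ha hLr hl1).le
    have h := hHD P rfl rfl hK₀M hl1 (hlk.trans hkK) h3l hmesh_l Ω₂ Ω (isBigBlockUnion_of_le hlk hΩ₂)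
      (isBigBlockUnion_of_le hlk hΩ) hsub A heHD le_rfl (reg223R_of_small C Ω A hlk hmesh_l heHD hδA hreg hteHD le_rfl) μ x x' hne
      (hx.margin' hlk) (hx'.margin' hlk) Γ hch hend hlen g M D D₀ 0 hg hD0 hD₀0 le_rfl hDx hDx' hD₀x hD₀x'
      (fun y z _ _ => Nat.cast_nonneg _)
    have e1 := covDeriv_dG_eq_neg_chi C Ω Ω₂ A msq a hsub hmsq hak (hΩl hlk) (hΩ₂l hlk) g (b := ⟨x', μ⟩) hx'.mem (hx'.shift_mem μ)
    have e2 := covDeriv_dG_eq_neg_chi C Ω Ω₂ A msq a hsub hmsq hak (hΩl hlk) (hΩ₂l hlk) g (b := ⟨x, μ⟩) hx.mem (hx.shift_mem μ)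
    rw [e1, e2, map_neg, neg_sub_neg, norm_sub_rev]
    refine h.trans ?_
    have hM : 0 ≤ M := (norm_nonneg _).trans (hg x)
    have hLl : (0 : ℝ) < (P.L : ℝ) ^ l := pow_pos (by exact_mod_cast P.hL) l
    have hexp := exp_p35_le8 (P := P) (by omega : 0 < K₀) hδ8 (by positivity : 0 ≤ D + D₀) hLl
    rw [add_zero]
    have hml : 0 < P.mesh l := P.mesh_pos l
    exact mul_le_mul_of_nonneg_right (mul_le_mul (mul_le_mul_of_nonneg_right hcHDle hml.le) hexp (Real.exp_pos _).le
      (by positivity)) hM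
  -- (I.2.34) for either region at level `l = j' + 1 < k` on its own block set
  have hCl : ∀ (Ω' : Finset (HiggsLattice.Site P 0)), IsBigBlockUnion k K₀ Ω' → Ω' ⊆ Ω →
      ∀ {j' : ℕ}, j' + 1 < k → ∀ s t : HiggsLattice.Site P (j' + 1) × Ix N,
      s.1 ∈ levelSet (j' + 1) Ω' → t.1 ∈ levelSet (j' + 1) Ω' →
      |mat (fluctCovA C Ω' A msq a (j' + 1)) s t|
        ≤ c₁ * P.mesh (j' + 1) ^ 2 * Real.exp (-(δ * (HiggsLattice.Site.tdist s.1 t.1 : ℝ))) := by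
    intro Ω' hΩ' h'Ω j' hlk s t hs ht'
    have hΩ'l : ∀ {l : ℕ}, l ≤ k → ∀ x x' : HiggsLattice.Site P 0, blockIter l x = blockIter l x' → (x ∈ Ω' ↔ x' ∈ Ω') :=
      fun hl => blockUnion_of_isBigBlockUnion hl hΩ'
    have hmesh_l : P.mesh (j' + 1) ≤ 1 := (mesh_mono P hlk.le).trans hmesh
    have hjK : j' + 1 < P.K := lt_of_lt_of_le hlk hkK
    have hcl : (P.L : ℝ) ^ (j' + 1) * δA ≤ c * |C.e| := by
      have hpow : (P.L : ℝ) ^ (j' + 1) ≤ (P.L : ℝ) ^ k := pow_le_pow_right₀ hLge1 hlk.le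
      nlinarith
    have hjk : j' < k := by omega
    have hpf : pieceF (towerR Ω' k) ⟨j', hjk⟩ = Ω' := pieceF_towerR ⟨j', hjk⟩ (hΩ'l hlk.le)
    have hregF : ∀ z ∈ pieceF (towerR Ω' k) ⟨j', hjk⟩, ∀ μ' ν : Fin P.d, |A ⟨z.shift ν, μ'⟩ - A ⟨z, μ'⟩| ≤ δA := by
      rw [hpf]; exact fun z hz => hreg z (h'Ω hz)
    have hj2 : j' + 2 ≤ k := by omega
    have hΛ := levelSet_blockUnion hjK.le (hΩ'l hlk.le) (hΩ'l hj2)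
    have h := (hCov C heA P rfl rfl (towerR Ω' k) hkK ⟨j', hjk⟩ hjK hmesh_l hΛ A hδA hregF hcl (Λ := levelSet (j' + 1) Ω')
      (subset_refl _) hs ht').1
    rw [hpf, mat_condCov232_levelSet C A hjK.le hmsq ha hLr (hΩ'l hlk.le) (hΩ'l hj2) hs] at h
    refine h.trans ?_
    have hexp : Real.exp (-(ρa * (HiggsLattice.Site.tdist s.1 t.1 : ℝ))) ≤ Real.exp (-(δ * (HiggsLattice.Site.tdist s.1 t.1 : ℝ))) :=
      Real.exp_le_exp.mpr (neg_le_neg (mul_le_mul_of_nonneg_right hδa (Nat.cast_nonneg _)))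
    calc P.mesh (j' + 1) ^ 2 * c₁a * Real.exp (-(ρa * (HiggsLattice.Site.tdist s.1 t.1 : ℝ)))
        ≤ P.mesh (j' + 1) ^ 2 * c₁ * Real.exp (-(δ * (HiggsLattice.Site.tdist s.1 t.1 : ℝ))) :=
          mul_le_mul (mul_le_mul_of_nonneg_left hc₁a' (sq_nonneg _)) hexp (Real.exp_pos _).le (by positivity)
      _ = _ := by ring
  -- (I.2.36) for `Ω` with `Λ = Ω₂^{(l)}`
  have h36l : ∀ {j' : ℕ}, j' + 1 < k → ∀ s t : HiggsLattice.Site P (j' + 1) × Ix N,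
      s.1 ∈ levelSet (j' + 1) Ω₂ → t.1 ∈ levelSet (j' + 1) Ω₂ →
      |mat (fluctCovA C Ω A msq a (j' + 1)) s t - mat (condCov232 C Ω A msq a (j' + 1) (levelSet (j' + 1) Ω₂)) s t|
        ≤ c₁ * P.mesh (j' + 1) ^ 2 * Real.exp (-(δ * ((HiggsLattice.Site.tdist s.1 t.1 : ℝ) + distC (levelSet (j' + 1) Ω₂) s.1
            + distC (levelSet (j' + 1) Ω₂) t.1))) := by
    intro j' hlk s t hs ht'
    have hmesh_l : P.mesh (j' + 1) ≤ 1 := (mesh_mono P hlk.le).trans hmesh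
    have hjK : j' + 1 < P.K := lt_of_lt_of_le hlk hkK
    have hcl : (P.L : ℝ) ^ (j' + 1) * δA ≤ c * |C.e| := by
      have hpow : (P.L : ℝ) ^ (j' + 1) ≤ (P.L : ℝ) ^ k := pow_le_pow_right₀ hLge1 hlk.le
      nlinarith
    have hjk : j' < k := by omega
    have hpf : pieceF (towerR Ω k) ⟨j', hjk⟩ = Ω := pieceF_towerR ⟨j', hjk⟩ (hΩl hlk.le)
    have hregF : ∀ z ∈ pieceF (towerR Ω k) ⟨j', hjk⟩, ∀ μ' ν : Fin P.d, |A ⟨z.shift ν, μ'⟩ - A ⟨z, μ'⟩| ≤ δA := by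
      rw [hpf]; exact hreg
    have hj2 : j' + 2 ≤ k := by omega
    have hΛ := levelSet_blockUnion hjK.le (hΩl hlk.le) (hΩl hj2)
    have hsub' : levelSet (j' + 1) Ω₂ ⊆ levelSet (j' + 1) Ω := levelSet_mono hsub _
    have h := (hCov C heA P rfl rfl (towerR Ω k) hkK ⟨j', hjk⟩ hjK hmesh_l hΛ A hδA hregF hcl (Λ := levelSet (j' + 1) Ω₂)
      hsub' hs ht').2
    have hblk : (towerR Ω k).block ⟨j', hjk⟩ = levelSet (j' + 1) Ω := rfl
    rw [hpf, hblk, mat_condCov232_levelSet C A hjK.le hmsq ha hLr (hΩl hlk.le) (hΩl hj2) (hsub' hs), abs_sub_comm] at h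
    refine h.trans ?_
    set S := (HiggsLattice.Site.tdist s.1 t.1 : ℝ) + distC (levelSet (j' + 1) Ω₂) s.1 + distC (levelSet (j' + 1) Ω₂) t.1 with hS
    have hS0 : 0 ≤ S := by rw [hS]; exact add_nonneg (add_nonneg (Nat.cast_nonneg _) (distC_nonneg _ _)) (distC_nonneg _ _)
    have hexp : Real.exp (-(ρa * S)) ≤ Real.exp (-(δ * S)) := Real.exp_le_exp.mpr (neg_le_neg (mul_le_mul_of_nonneg_right hδa hS0))
    calc P.mesh (j' + 1) ^ 2 * c₁a * Real.exp (-(ρa * S)) ≤ P.mesh (j' + 1) ^ 2 * c₁ * Real.exp (-(δ * S)) :=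
          mul_le_mul (mul_le_mul_of_nonneg_left hc₁a' (sq_nonneg _)) hexp (Real.exp_pos _).le (by positivity)
      _ = _ := by ring
  -- (I.2.38) for the pair on `Ω₂^{(l)}`
  have h38l : ∀ {j' : ℕ}, j' + 1 < k → ∀ s t : HiggsLattice.Site P (j' + 1) × Ix N,
      s.1 ∈ levelSet (j' + 1) Ω₂ → t.1 ∈ levelSet (j' + 1) Ω₂ →
      |mat (condCov232 C Ω₂ A msq a (j' + 1) (levelSet (j' + 1) Ω₂)) s t
          - mat (condCov232 C Ω A msq a (j' + 1) (levelSet (j' + 1) Ω₂)) s t|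
        ≤ c₁ * P.mesh (j' + 1) ^ 2 * Real.exp (-(δ * ((HiggsLattice.Site.tdist s.1 t.1 : ℝ) + distC (levelSet (j' + 1) Ω₂) s.1
            + distC (levelSet (j' + 1) Ω₂) t.1))) := by
    intro j' hlk s t hs ht'
    have hmesh_l : P.mesh (j' + 1) ≤ 1 := (mesh_mono P hlk.le).trans hmesh
    have hjK : j' + 1 < P.K := lt_of_lt_of_le hlk hkK
    have hcl : (P.L : ℝ) ^ (j' + 1) * δA ≤ c * |C.e| := by
      have hpow : (P.L : ℝ) ^ (j' + 1) ≤ (P.L : ℝ) ^ k := pow_le_pow_right₀ hLge1 hlk.le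
      nlinarith
    have hjk : j' < k := by omega
    have hpf : pieceF (towerR Ω k) ⟨j', hjk⟩ = Ω := pieceF_towerR ⟨j', hjk⟩ (hΩl hlk.le)
    have hpf₂ : pieceF (towerR Ω₂ k) ⟨j', hjk⟩ = Ω₂ := pieceF_towerR ⟨j', hjk⟩ (hΩ₂l hlk.le)
    have hregF : ∀ z ∈ pieceF (towerR Ω k) ⟨j', hjk⟩, ∀ μ' ν : Fin P.d, |A ⟨z.shift ν, μ'⟩ - A ⟨z, μ'⟩| ≤ δA := by
      rw [hpf]; exact hreg
    have hj2 : j' + 2 ≤ k := by omega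
    have hΛ := levelSet_blockUnion hjK.le (hΩl hlk.le) (hΩl hj2)
    have hΛ₂ := levelSet_blockUnion hjK.le (hΩ₂l hlk.le) (hΩ₂l hj2)
    have hsub' : levelSet (j' + 1) Ω₂ ⊆ levelSet (j' + 1) Ω := levelSet_mono hsub _
    have h : |mat (condCov232 C (pieceF (towerR Ω₂ k) ⟨j', hjk⟩) A msq a (j' + 1) (levelSet (j' + 1) Ω₂)) s t
        - mat (condCov232 C (pieceF (towerR Ω k) ⟨j', hjk⟩) A msq a (j' + 1) (levelSet (j' + 1) Ω₂)) s t|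
        ≤ P.mesh (j' + 1) ^ 2 * c₁b * Real.exp (-(ρb * ((HiggsLattice.Site.tdist s.1 t.1 : ℝ)
            + distC (levelSet (j' + 1) Ω₂) s.1 + distC (levelSet (j' + 1) Ω₂) t.1))) :=
      hCov38 C heB P rfl rfl (towerR Ω₂ k) (towerR Ω k) hkK ⟨j', hjk⟩ hjK hmesh_l hΛ₂ hΛ hsub' A hδA hregF hcl
        (Λ := levelSet (j' + 1) Ω₂) (subset_refl _) hs ht'
    rw [hpf, hpf₂] at h
    refine h.trans ?_
    set S := (HiggsLattice.Site.tdist s.1 t.1 : ℝ) + distC (levelSet (j' + 1) Ω₂) s.1 + distC (levelSet (j' + 1) Ω₂) t.1 with hS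
    have hS0 : 0 ≤ S := by rw [hS]; exact add_nonneg (add_nonneg (Nat.cast_nonneg _) (distC_nonneg _ _)) (distC_nonneg _ _)
    have hexp : Real.exp (-(ρb * S)) ≤ Real.exp (-(δ * S)) := Real.exp_le_exp.mpr (neg_le_neg (mul_le_mul_of_nonneg_right hδb hS0))
    calc P.mesh (j' + 1) ^ 2 * c₁b * Real.exp (-(ρb * S)) ≤ P.mesh (j' + 1) ^ 2 * c₁ * Real.exp (-(δ * S)) :=
          mul_le_mul (mul_le_mul_of_nonneg_left hc₁b' (sq_nonneg _)) hexp (Real.exp_pos _).le (by positivity)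
      _ = _ := by ring
  -- exponent bookkeeping: the carrier's exponentials at rate `δ₁ = δ/(4L)`
  have hgood₂ : ∀ x, Interior k K₀ Ω₂ x → x ∈ Ω₂ := fun x hx => hx.mem
  have hgood₂' : ∀ (x : HiggsLattice.Site P 0) (μ : Fin P.d), Interior k K₀ Ω₂ x → x.shift μ ∈ Ω₂ := fun x μ hx => hx.shift_mem μ
  have hr_eq : ∀ j : ℕ, δ / (4 * P.L) * (P.mesh j)⁻¹ * P.mesh 0 = δ / (4 * P.L) / (P.L : ℝ) ^ j := by
    intro j
    rw [mesh_eq_pow_mul P j, mul_inv, div_eq_mul_inv _ ((P.L : ℝ) ^ j)]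
    have h0 : (P.mesh 0)⁻¹ * P.mesh 0 = 1 := inv_mul_cancel₀ (P.mesh_pos 0).ne'
    calc δ / (4 * P.L) * (((P.L : ℝ) ^ j)⁻¹ * (P.mesh 0)⁻¹) * P.mesh 0
        = δ / (4 * P.L) * ((P.L : ℝ) ^ j)⁻¹ * ((P.mesh 0)⁻¹ * P.mesh 0) := by ring
      _ = _ := by rw [h0, mul_one]
  have htarget : ∀ (j : ℕ) {γ T : ℝ}, 0 < T → δ / (4 * P.L) / (P.L : ℝ) ^ j * T ≤ γ →
      hwgt Ω₂ γ T x₁ x₂ x' ≤ Real.exp (-(δ / (4 * P.L) * (P.mesh j)⁻¹ * (P.mesh 0 * dm))) *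
        Real.exp (-(δ / (4 * P.L) * (P.mesh j)⁻¹ * (P.mesh 0 * mm))) := by
    intro j γ T hT hrT
    have e1 : δ / (4 * P.L) * (P.mesh j)⁻¹ * (P.mesh 0 * dm) = δ / (4 * P.L) / (P.L : ℝ) ^ j * dm := by rw [← hr_eq j]; ring
    have e2 : δ / (4 * P.L) * (P.mesh j)⁻¹ * (P.mesh 0 * mm) = δ / (4 * P.L) / (P.L : ℝ) ^ j * mm := by rw [← hr_eq j]; ring
    rw [e1, e2]
    exact hwgt_le_exp hT hrT x₁ x₂ x'
  have h41 : δ / (4 * P.L) * (P.L : ℝ) = δ / 4 := by field_simp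
  have hδ1le : δ / (4 * P.L) ≤ δ / 4 := div_le_div_of_nonneg_left hδpos.le (by norm_num) (by nlinarith)
  have hzero_le : (N : ℝ) * Real.sqrt N * c₂m * (P.L : ℝ) ≤ 2 * cst25 P.d P.L N a c₀m c₁ c₂m δ := by
    have hL2 : (P.L : ℝ) ≤ (P.L : ℝ) ^ 2 := by nlinarith
    have h1 := (mul_le_mul_of_nonneg_left hL2 (by positivity : (0 : ℝ) ≤ (N : ℝ) * Real.sqrt N * c₂m)).trans
      (le_cst25_zero (d := P.d) (a := a) (δ := δ) N hc₀m0 hc₁0 hc₂m0)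
    linarith
  have hpos_le : (N : ℝ) * a ^ 2 * (2 * kT N c₀m c₁ c₂m δ (profile P N (δ / 2)) (profile P N (δ / 2 / 2)))
      ≤ 2 * cst25 P.d P.L N a c₀m c₁ c₂m δ := by
    have h := le_cst25_pos (d := P.d) (L := P.L) (a := a) (c₀ := c₀m) (c₁ := c₁) (δ := δ) N hc₂m0
    calc (N : ℝ) * a ^ 2 * (2 * kT N c₀m c₁ c₂m δ (profile P N (δ / 2)) (profile P N (δ / 2 / 2)))
        = 2 * ((N : ℝ) * a ^ 2 * kT N c₀m c₁ c₂m δ (profile P N (δ / 2)) (profile P N (δ / 2 / 2))) := by ring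
      _ ≤ _ := by linarith
  -- the explicit form from a weighted bound at level `l`: `W_l·T ≤ B·u·hwgt γ (L^l)` ⇒ the target
  have hfinish : ∀ {l : ℕ} {B γ : ℝ}, 0 ≤ B → B ≤ 2 * cst25 P.d P.L N a c₀m c₁ c₂m δ → 0 < (P.L : ℝ) ^ l →
      (HiggsLattice.Site.tdist x₁ x₂ : ℝ) / (P.L : ℝ) ^ l ≤ t12 / (P.L : ℝ) ^ j →
      δ / (4 * P.L) / (P.L : ℝ) ^ j * (P.L : ℝ) ^ l ≤ γ →
      (((HiggsLattice.Site.tdist x₁ x₂ : ℝ) / (P.L : ℝ) ^ l)⁻¹) ^ α * dHolderTerm C Ω Ω₂ A msq a k j μ x₁ x₂ x' Γ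
        ≤ B * (P.mesh j * (P.mesh j ^ P.d)⁻¹) * hwgt Ω₂ γ ((P.L : ℝ) ^ l) x₁ x₂ x' →
      dHolderTerm C Ω Ω₂ A msq a k j μ x₁ x₂ x' Γ
        ≤ (P.mesh 0 * t12) ^ α * (2 * cst25 P.d P.L N a c₀m c₁ c₂m δ * P.mesh j ^ ((1 : ℝ) - (P.d : ℝ) - α)) *
          Real.exp (-(δ / (4 * P.L) * (P.mesh j)⁻¹ * (P.mesh 0 * dm))) *
          Real.exp (-(δ / (4 * P.L) * (P.mesh j)⁻¹ * (P.mesh 0 * mm))) := by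
    intro l B γ hB0 hBle hTl hwle hrT h
    have hwl : 0 < (HiggsLattice.Site.tdist x₁ x₂ : ℝ) / (P.L : ℝ) ^ l := div_pos ht12pos hTl
    have h1 := le_of_weight_mul_le hwl h
    have hmj := P.mesh_pos j
    have hu0 : 0 ≤ P.mesh j * (P.mesh j ^ P.d)⁻¹ := by positivity
    have hHw0 : 0 ≤ hwgt Ω₂ γ ((P.L : ℝ) ^ l) x₁ x₂ x' := hwgt_nonneg Ω₂ _ _ _ _ _
    -- the weight at level `l` is below the weight at level `j`
    have hwt : ((HiggsLattice.Site.tdist x₁ x₂ : ℝ) / (P.L : ℝ) ^ l) ^ α ≤ (P.mesh 0 * t12) ^ α * (P.mesh j ^ α)⁻¹ := by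
      rw [← weight_inv_eq j ht12pos.le]
      exact Real.rpow_le_rpow hwl.le hwle hα0
    have hwt0 : 0 ≤ (P.mesh 0 * t12) ^ α * (P.mesh j ^ α)⁻¹ := by
      have : 0 ≤ (P.mesh 0 * t12) ^ α := Real.rpow_nonneg (by positivity) _
      have : 0 < P.mesh j ^ α := Real.rpow_pos_of_pos hmj α
      positivity
    have htg := htarget j hTl hrT
    calc dHolderTerm C Ω Ω₂ A msq a k j μ x₁ x₂ x' Γ
        ≤ ((HiggsLattice.Site.tdist x₁ x₂ : ℝ) / (P.L : ℝ) ^ l) ^ α * (B * (P.mesh j * (P.mesh j ^ P.d)⁻¹) *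
            hwgt Ω₂ γ ((P.L : ℝ) ^ l) x₁ x₂ x') := h1
      _ ≤ ((P.mesh 0 * t12) ^ α * (P.mesh j ^ α)⁻¹) * ((2 * cst25 P.d P.L N a c₀m c₁ c₂m δ) * (P.mesh j * (P.mesh j ^ P.d)⁻¹) *
            (Real.exp (-(δ / (4 * P.L) * (P.mesh j)⁻¹ * (P.mesh 0 * dm))) *
              Real.exp (-(δ / (4 * P.L) * (P.mesh j)⁻¹ * (P.mesh 0 * mm))))) :=
          mul_le_mul hwt (mul_le_mul (mul_le_mul_of_nonneg_right hBle hu0) htg hHw0 (by positivity)) (by positivity) hwt0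
      _ = _ := by rw [rpow_one_sub_sub]; ring
  rcases Nat.eq_zero_or_pos j with rfl | hj1
  · -- `j = 0`: `δpiece_0 = δG_1`, the Hölder member of (I.2.26) at level `1`
    have hT : (0 : ℝ) < (P.L : ℝ) ^ 1 := pow_pos (by exact_mod_cast P.hL) 1
    refine hfinish (l := 1) (γ := δ) (by positivity) hzero_le hT ?_ ?_ ?_
    · rw [pow_zero, pow_one, ht12]
      exact div_le_div_of_nonneg_left (Nat.cast_nonneg _) one_pos (by exact_mod_cast P.hL)
    · rw [pow_zero, div_one, pow_one, h41]; linarith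
    · exact absH_dPiece_zero_le C Ω Ω₂ A msq (k := k) (α := α) hc₂m0 hδpos (h26Hl le_rfl hk1) μ hne hx₁ hx₂ x' hΓ
  · by_cases hjk : j < k
    · obtain ⟨j', rfl⟩ : ∃ j', j = j' + 1 := ⟨j - 1, by omega⟩
      have hjK : j' + 1 ≤ P.K := hjk.le.trans hkK
      have hj2 : j' + 2 ≤ k := by omega
      have hT : (0 : ℝ) < (P.L : ℝ) ^ (j' + 1) := pow_pos (by exact_mod_cast P.hL) _
      have hB0 : 0 ≤ (N : ℝ) * a ^ 2 * (2 * kT N c₀m c₁ c₂m δ (profile P N (δ / 2)) (profile P N (δ / 2 / 2))) := by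
        have := kT_nonneg N (δ := δ) (K₂ := profile P N (δ / 2)) (K₄ := profile P N (δ / 2 / 2)) hc₀m0 hc₁0 hc₂m0
        positivity
      refine hfinish (l := j' + 1) (γ := δ / 4) hB0 hpos_le hT le_rfl ?_ ?_
      · rw [div_mul_cancel₀ _ hT.ne']; exact hδ1le
      · exact absH_dPiece_pos_le C Ω Ω₂ A msq hjk hjK hsub hmsq ha hL1' (hΩl hjk.le) (hΩ₂l hjk.le) (hΩ₂l hj2) hz₀ hgood₂
          hgood₂' hc₀m0 hc₁0 hc₂m0 hδpos (h26l hj1 hjk.le) (h26Hl hj1 hjk.le) (hGl hj1 hjk.le) (hH₂l hj1 hjk.le)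
          (hCl Ω hΩ (subset_refl _) hjk) (hCl Ω₂ hΩ₂ hsub hjk) (h36l hjk) (h38l hjk) μ hne hx₁ hx₂ hx' hΓ
    · rw [dHolderTerm_eq_zero_of_le C Ω Ω₂ A msq hj1 (not_lt.mp hjk)]
      exact hRHS

end Main

end Literature.MathematicalPhysics.QuantumFieldTheory.Balaban1983to89.B3DeltaGkHolderRegularNested
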